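import Literature.Computability.Cryptography.WordRAMToTM2Interp
import Literature.Computability.Cryptography.WordRAMExec
import Literature.Computability.Cryptography.FGCoreProblems
import HarnessLib

/-!
# Word-RAM programs on multi-stack machines, IV: duplicate-free log, 3SUM queries, the oracle interpreter

Family `fine-grained` / trunk `CplxCore`, continuing `WordRAMToTM2Memory.lean` (the memory log,
`memRead`, `memWrite`) and `WordRAMToTM2Interp.lean` (the interpreter of oracle-free programs).
This file is the machine-level content of the change of machine model *at SETH granularity*
behind `Literature.Computability.FineGrained.sparseKSATInExpTime_of_cnfSATInThreeSumOracleRAMTime`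
(`NSETHNonReducibility.lean`; Cook–Reckhow 1973, §2: a random-access machine of time `T` and
memory `S` is simulated by a multitape machine in time `T · poly(S)`): an interpreter `interpQ M`
of an arbitrary word-RAM program `M` run with a **3SUM oracle** (every query answered by one word,
`[1]`/`[0]` according to `HasThreeSum` of the zig-zag decoded segment), whose cost is *linear* in
the number of simulated steps, each step costing a polynomial in the word size and the memory
bound only (`runs_interpQ`, `stepCostQ_le_pow`).

Two things change with respect to `WordRAMToTM2Interp.lean`.

* **Stores delete before they prepend** (`memStore`), so the keys of the log stay pairwise
  distinct and the log never holds more entries than there are addresses `≤ V + 1` (`LogInv`,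
  `LogInv.length_le`); the interpreter of `WordRAMToTM2Interp.lean` prepends only, its log grows
  with the running time, and its cost is quadratic in the number of steps — enough for ETH-type
  statements, not for SETH-type ones.
* **Queries are simulated**: the queried segment is collected as an item list (`qRead`:
  `readLoop` over a unary counter obtained by Horner from the length operand), 3SUM is decided on
  it by brute force over all triples (`loop1` ⊇ `loop2` ⊇ `loop3` ⊇ `test3`, reading the parity
  bit of each numeral to accumulate the positive and negative parts of the zig-zag decoding,
  `posPart`/`negPart`, and comparing them), and the answer is written back (`answer`: length `1`
  at the answer address, the bit reduced modulo `2^W` right after), exactly as `WordRAM.step`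
  prescribes.

Contents.

* `πLA l a`, `graft_eq_of_PIReg`, `runs_popItem_mem_lit/cl` — the generic item reader `popItem`
  (`StackItemLists.lean`) embedded into the interpreter's register file;
* `repush`, `delEntry`, `delLoop`, `memDelete`, `memStore` (`runs_memStore`, cost `storeCostD`),
  `storeLog`, `Represents.store`, `nodup_keys_storeLog`, `BoundedLog.storeLog`, `KeysBelow`,
  `length_le_of_nodup_keysBelow` — the duplicate-free store and its invariants;
* `valItems`, `readBody`/`readLoop` (`runs_readLoop`) — reading a memory segment into an item list;
* `posPart`, `negPart`, `tst`, `accP`/`accN`, `accum`, `finish`, `test3` (`runs_test3`, cost `T3`),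
  `loop3`/`loop2`/`loop1` with the functional models `F2`, `F1` (`runs_loop1`, costs `C3`, `C2`,
  `C1`), `F1_eq_true_iff`, `intEquivNat_symm_eq`, `tst_eq_true_iff`, `exists_get₃_iff`,
  `hasThreeSum_iff_exists_sublist`, `hasThreeSum_iff_F1_reverse` — **the brute force decides 3SUM
  of the zig-zag decoded query**;
* `ThreeSumAnswers`, `step_memLE_of_length_le_one`, `storeCode`, `qRead` (`runs_qRead`), `answer`
  (`runs_answer`), `instrCodeQ`, `dispatchQ`, `bodyQ`, `interpQ`, `LogInv`, `runs_instrCodeQ`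
  (**one instruction**, all six kinds, against `WordRAM.step` with a 3SUM oracle and `zeroCoins`),
  `runs_bodyQ_step`, `runs_interpQ` (**a halting run of `n` steps within
  `n · (stepCostQ + 2 pcBound + 5) + 1`**), `stepCostQ_le_pow` (`≤ 9100 Z⁵` for
  `W, β, V + 2, pcBound ≤ Z`).

Proof technique throughout, as in the files continued: routines are written left-nested, their
specifications are assembled left to right by `Runs.seq`, the register file being normalised to
`state ρ F` by `simp` between steps; loops over item lists are proved by induction on the list,
the popped first bit of each item being pushed back before the generic reader parses the item.

## References

* S. A. Cook, R. A. Reckhow, *Time bounded random access machines*, JCSS 7 (1973) 354–375, §2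
  (random-access machines simulated by multitape Turing machines).
* A. Gajentaan, M. H. Overmars, *On a class of `O(n²)` problems in computational geometry*,
  CGTA 5 (1995), §1 (3SUM).
* V. Vassilevska Williams, *On some fine-grained questions in algorithms and complexity*,
  Proc. ICM 2018, §2 (word RAM with oracle calls, Def. 2.1).
* B. Korte, J. Vygen, *Combinatorial Optimization*, Springer 2002, §15.2, p. 341.
* S. Arora, B. Barak, *Computational Complexity: A Modern Approach*, CUP 2009, §0.1
  (self-delimiting codes), §1.3.
* T. Nipkow, G. Klein, *Concrete Semantics with Isabelle/HOL*, Springer 2014, §7.2 (big-step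
  reasoning about loops).
-/

namespace Literature.Computability.Cryptography.WordRAM.ToTM2

open _root_.Computability Complexity Complexity.Com St
open Complexity.TokConv (incRes bitsToNat_incRes length_incRes_le bitsToNat_flag)

/-! ### Embedding the item reader -/

/-- The register assignment of `popItem` with list register `l` and payload register `a` (sign
flag on `incl`, scratch `it1`, state `it2`). [folklore] -/
def πLA (l a : K) : PIReg → K ⊕ AReg
  | .L => Sum.inl l
  | .A => Sum.inl a
  | .S => Sum.inl K.incl
  | .T => Sum.inl K.it1
  | .Q => Sum.inl K.it2

/-- `πLA l a` is injective for admissible `l`, `a`. [folklore] -/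
theorem πLA_injective {l a : K} (hla : l ≠ a) (hl1 : l ≠ K.incl) (hl2 : l ≠ K.it1) (hl3 : l ≠ K.it2)
    (ha1 : a ≠ K.incl) (ha2 : a ≠ K.it1) (ha3 : a ≠ K.it2) : Function.Injective (πLA l a) := by
  intro i j hij
  cases i <;> cases j <;> simp only [πLA, Sum.inl.injEq] at hij <;> first
    | rfl
    | exact absurd hij hla | exact absurd hij.symm hla
    | exact absurd hij hl1 | exact absurd hij.symm hl1
    | exact absurd hij hl2 | exact absurd hij.symm hl2
    | exact absurd hij hl3 | exact absurd hij.symm hl3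
    | exact absurd hij ha1 | exact absurd hij.symm ha1
    | exact absurd hij ha2 | exact absurd hij.symm ha2
    | exact absurd hij ha3 | exact absurd hij.symm ha3
    | exact absurd hij (by decide)

/-- A file grafted along an injective assignment of the five `popItem` registers is the ambient
file updated at the five images. [folklore] -/
theorem graft_eq_of_PIReg {κ : Type} [DecidableEq κ] (S : Regs κ) {f : PIReg → κ}
    (hf : Function.Injective f) (R' : Regs PIReg) :
    graft S f R' = Function.update (Function.update (Function.update (Function.update
      (Function.update S (f .Q) (R' .Q)) (f .T) (R' .T)) (f .S) (R' .S)) (f .A) (R' .A)) (f .L) (R' .L) := by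
  funext j
  by_cases h : ∃ i, f i = j
  · obtain ⟨i, rfl⟩ := h
    rw [graft_apply _ hf]
    cases i <;> simp [hf.eq_iff]
  · push Not at h
    rw [graft_of_not _ _ _ h]
    simp [(h _).symm]

/-- **The embedded reader on the log.** From a file whose `mem` holds an item `encItem w s` above
`rest` and whose `lit`, `incl`, `it1`, `it2` are empty, `popItem.map (πLA mem lit)` leaves `rest`
on `mem`, the payload `w` on `lit` and the sign on `incl`. [folklore] -/
theorem runs_popItem_mem_lit (ρ : St) (F : Regs AReg) (w : List Bool) (s : Bool) (rest : List Bool)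
    (hmem : ρ.mem = encItem w s ++ rest) (hlit : ρ.lit = []) (hincl : ρ.incl = []) (hit1 : ρ.it1 = [])
    (hit2 : ρ.it2 = []) :
    Runs (popItem.map (πLA K.mem K.lit)) (state ρ F)
      (state { ρ with mem := rest, lit := w, incl := flag s } F) (13 * (encItem w s ++ rest).length + 6) := by
  have hinj : Function.Injective (πLA K.mem K.lit) :=
    πLA_injective (by decide) (by decide) (by decide) (by decide) (by decide) (by decide) (by decide)
  have h := Runs.map hinj (runs_popItem w s rest) (state ρ F)
    (fun i => by cases i <;> simp [πLA, state, hmem, hlit, hincl, hit1, hit2])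
  rw [graft_eq_of_PIReg _ hinj] at h
  refine h.of_eq ?_ le_rfl
  simp only [πLA, PIReg.file_Q, PIReg.file_T, PIReg.file_S, PIReg.file_A, PIReg.file_L, state,
    Sum.update_elim_inl, update_regs_it2, update_regs_it1, update_regs_incl, update_regs_lit, update_regs_mem]
  congr 1
  cases ρ; simp only at hit1 hit2; simp [hit1, hit2]

/-- The embedded reader with payload register `cl`. [folklore] -/
theorem runs_popItem_mem_cl (ρ : St) (F : Regs AReg) (w : List Bool) (s : Bool) (rest : List Bool)
    (hmem : ρ.mem = encItem w s ++ rest) (hcl : ρ.cl = []) (hincl : ρ.incl = []) (hit1 : ρ.it1 = [])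
    (hit2 : ρ.it2 = []) :
    Runs (popItem.map (πLA K.mem K.cl)) (state ρ F)
      (state { ρ with mem := rest, cl := w, incl := flag s } F) (13 * (encItem w s ++ rest).length + 6) := by
  have hinj : Function.Injective (πLA K.mem K.cl) :=
    πLA_injective (by decide) (by decide) (by decide) (by decide) (by decide) (by decide) (by decide)
  have h := Runs.map hinj (runs_popItem w s rest) (state ρ F)
    (fun i => by cases i <;> simp [πLA, state, hmem, hcl, hincl, hit1, hit2])
  rw [graft_eq_of_PIReg _ hinj] at h
  refine h.of_eq ?_ le_rfl
  simp only [πLA, PIReg.file_Q, PIReg.file_T, PIReg.file_S, PIReg.file_A, PIReg.file_L, state,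
    Sum.update_elim_inl, update_regs_it2, update_regs_it1, update_regs_incl, update_regs_cl, update_regs_mem]
  congr 1
  cases ρ; simp only at hit1 hit2; simp [hit1, hit2]

/-! ### Re-pushing an item, reversed -/

section Generic

variable {ι : Type} [DecidableEq ι]

/-- The re-push loop: pop `src` bit by bit, pushing `1, bit` on `dst`. [folklore] -/
def repushLoop (src dst : ι) : Com ι := loop src (push dst true ;; push dst true) (push dst true ;; push dst false)

/-- Effect of the re-push loop: `dst := (src.reverse.flatMap [·, 1]) ++ dst`, `src` emptied, cost
`4|src| + 1`. [folklore] -/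
theorem runs_repushLoop {src dst : ι} (h : src ≠ dst) : ∀ (v : List Bool) (R : Regs ι), R src = v →
    Runs (repushLoop src dst) R
      (Function.update (Function.update R src []) dst ((v.reverse.flatMap fun b => [b, true]) ++ R dst))
      (4 * v.length + 1)
  | [], R, hR => by
    refine (Runs.loop_nil _ _ hR).of_eq ?_ (by simp)
    ext i : 1
    simp only [Function.update_apply]
    split_ifs <;> simp_all
  | b :: v, R, hR => by
    have hbody : ∀ b' : Bool, Runs (push dst true ;; push dst b') (Function.update R src v)
        (Function.update (Function.update R src v) dst (b' :: true :: R dst)) (1 + 1) := fun b' => by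
      refine ((Runs.push dst true _).seq (Runs.push dst b' _)).of_eq ?_ le_rfl
      simp [Function.update_of_ne h.symm]
    have ih := fun b' : Bool => runs_repushLoop h v (Function.update (Function.update R src v) dst (b' :: true :: R dst))
      (by simp [Function.update_of_ne h])
    have hfin : ∀ b' : Bool, Function.update (Function.update (Function.update (Function.update R src v) dst
        (b' :: true :: R dst)) src []) dst ((v.reverse.flatMap fun b => [b, true]) ++
          (Function.update (Function.update R src v) dst (b' :: true :: R dst)) dst) =
        Function.update (Function.update R src []) dst (((b' :: v).reverse.flatMap fun b => [b, true]) ++ R dst) := by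
      intro b'
      ext i : 1
      simp only [Function.update_apply]
      split_ifs <;> simp_all
    cases b
    · exact (Runs.loop_false hR (hbody false) ((ih false).of_eq (hfin false) le_rfl)).of_eq rfl (by simp; omega)
    · exact (Runs.loop_true hR (hbody true) ((ih true).of_eq (hfin true) le_rfl)).of_eq rfl (by simp; omega)

/-- The code of an item, reversed, is the sign, a `0`, then the payload bits each followed by a `1`.
[folklore] -/
theorem reverse_encItem (w : List Bool) (s : Bool) :
    (encItem w s).reverse = s :: false :: (w.flatMap fun b => [b, true]) := by
  simp only [encItem, List.reverse_append, List.reverse_cons, List.reverse_nil, List.nil_append,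
    List.cons_append, List.cons.injEq, true_and]
  induction w with
  | nil => simp
  | cons b w ih =>
    rw [List.reverse_cons, List.flatMap_append, List.reverse_append, ih]
    simp

end Generic

/-- `repush r s`: push the code of the item `(r.reverse, s)`, reversed, onto `mem2`; `r` emptied.
[folklore] -/
def repush (r : K) (s : Bool) : Com (K ⊕ AReg) :=
  (repushLoop (Sum.inl r) (Sum.inl K.mem2) ;; push (Sum.inl K.mem2) false) ;; push (Sum.inl K.mem2) s

/-- Effect of `repush` (register `r ≠ mem2` holding `u`): `mem2 := (encItem u.reverse s).reverse ++ mem2`,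
cost `4|u| + 3`. [folklore] -/
theorem runs_repush {r : K} (hr : r ≠ K.mem2) (s : Bool) (R : Regs (K ⊕ AReg)) :
    Runs (repush r s) R
      (Function.update (Function.update R (Sum.inl r) []) (Sum.inl K.mem2)
        ((encItem (R (Sum.inl r)).reverse s).reverse ++ R (Sum.inl K.mem2)))
      (4 * (R (Sum.inl r)).length + 3) := by
  have hne : (Sum.inl r : K ⊕ AReg) ≠ Sum.inl K.mem2 := by simpa using hr
  have h1 := runs_repushLoop hne (R (Sum.inl r)) R rfl
  have h2 := (h1.seq (Runs.push (Sum.inl K.mem2) false _)).seq (Runs.push (Sum.inl K.mem2) s _)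
  refine h2.of_eq ?_ ?_
  · rw [reverse_encItem]
    simp [Function.update_idem]
  · omega

/-! ### One entry of the deletion pass -/

/-- `DClean ρ`: the scratch registers of the deletion pass are empty. [folklore] -/
structure DClean (ρ : St) : Prop where
  lit : ρ.lit = []
  cl : ρ.cl = []
  incl : ρ.incl = []
  it1 : ρ.it1 = []
  it2 : ρ.it2 = []
  un : ρ.un = []
  a0 : ρ.a0 = []
  ifl : ρ.ifl = []
  tmp : ρ.tmp = []

/-- `delEntry`: read the key item (payload on `lit`) and the value item (payload on `cl`) of the
first entry of `mem`, compare the key with the target held on `key` (string equality `eqCheck` on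
copies), and re-push the entry, reversed, onto `mem2` iff the keys differ. [folklore] -/
def delEntry : Com (K ⊕ AReg) :=
  ((((((popItem.map (πLA K.mem K.lit) ;; popItem.map (πLA K.mem K.cl)) ;; clear (Sum.inl K.incl)) ;;
    pour (Sum.inl K.lit) (Sum.inl K.un)) ;; copy (Sum.inl K.un) (Sum.inl K.lit) (Sum.inl K.tmp) (Sum.inr AReg.s)) ;;
    copy (Sum.inl K.key) (Sum.inl K.a0) (Sum.inl K.tmp) (Sum.inr AReg.s)) ;;
    eqCheck (Sum.inl K.lit) (Sum.inl K.a0) (Sum.inl K.ifl)) ;;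
  ifFlag (Sum.inl K.ifl) ((clear (Sum.inl K.ifl) ;; clear (Sum.inl K.un)) ;; clear (Sum.inl K.cl))
    (repush K.un false ;; (pour (Sum.inl K.cl) (Sum.inl K.lit) ;; repush K.lit true))

/-- The contribution of an entry `(kk, v)` to the reversed code of the kept entries, for the target
key `k`: nothing if `kk = k`, else the entry code reversed. [folklore] -/
def keptRev (k kk v : List Bool) : List Bool :=
  if kk = k then [] else (encItem v true).reverse ++ (encItem kk.reverse false).reverse

/-- **One entry.** From a file whose `mem` starts with the entry `(kk, v)`, target `k` on `key`,
clean scratch, `delEntry` removes the entry from `mem` and pushes `keptRev k kk v` on `mem2`.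
[folklore] -/
theorem runs_delEntry (ρ : St) (x y z t u f g : List Bool) (kk v k rest : List Bool)
    (hmem : ρ.mem = encItem kk.reverse false ++ encItem v true ++ rest) (hkey : ρ.key = k) (hc : DClean ρ) :
    Runs delEntry (state ρ (AReg.file x y z [] t u f g))
      (state { ρ with mem := rest, mem2 := keptRev k kk v ++ ρ.mem2 } (AReg.file x y z [] t u f g))
      (26 * (encItem kk.reverse false ++ encItem v true ++ rest).length + 36 * kk.length + 12 * k.length +
        11 * v.length + 60) := by
  set F : Regs AReg := AReg.file x y z [] t u f g with hF
  have c1 := runs_popItem_mem_lit ρ F kk.reverse false (encItem v true ++ rest) (by rw [hmem, List.append_assoc])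
    hc.lit hc.incl hc.it1 hc.it2
  have c2 := c1.seq (runs_popItem_mem_cl _ F v true rest (by simp) (by simp [hc.cl]) (by simp) (by simp [hc.it1])
    (by simp [hc.it2]))
  have c3 := c2.seq (runs_clear_flag (Sum.inl K.incl : K ⊕ AReg) (by simp [state]))
  have c4 := c3.seq (runs_pour (a := (Sum.inl K.lit : K ⊕ AReg)) (b := Sum.inl K.un) (by simp) _)
  have c5 := c4.seq (runs_copy (a := (Sum.inl K.un : K ⊕ AReg)) (b := Sum.inl K.lit) (t := Sum.inl K.tmp) (u := Sum.inr AReg.s)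
    (by simp) (by simp) (by simp) (by simp) (by simp) (by simp) _ (by simp [state, hc.tmp]) (by simp [state, hF]))
  have c6 := c5.seq (runs_copy (a := (Sum.inl K.key : K ⊕ AReg)) (b := Sum.inl K.a0) (t := Sum.inl K.tmp) (u := Sum.inr AReg.s)
    (by simp) (by simp) (by simp) (by simp) (by simp) (by simp) _ (by simp [state, hc.tmp]) (by simp [state, hF]))
  have c7 := c6.seq (runs_eqCheck (a := (Sum.inl K.lit : K ⊕ AReg)) (b := Sum.inl K.a0) (F := Sum.inl K.ifl)
    (by simp) (by simp) (by simp) _)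
  simp only [state, Sum.elim_inl, Sum.update_elim_inl, update_regs_incl, regs_lit, regs_un, hc.un,
    List.reverse_reverse, List.append_nil, update_regs_lit, update_regs_un, regs_key, hkey, regs_a0, hc.a0,
    update_regs_a0, regs_ifl, hc.ifl, update_regs_ifl, List.length_nil] at c7
  by_cases hkk : kk = k
  · -- the keys agree: drop the entry
    subst hkk
    have c8 := c7.seq (runs_ifFlag_true (F := (Sum.inl K.ifl : K ⊕ AReg))
      (repush K.un false ;; (pour (Sum.inl K.cl) (Sum.inl K.lit) ;; repush K.lit true)) (by simp) ((((runs_clear_flag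
      (Sum.inl K.ifl : K ⊕ AReg) (by simp)).seq (runs_clear (Sum.inl K.un : K ⊕ AReg) _)).seq
      (runs_clear (Sum.inl K.cl : K ⊕ AReg) _))))
    refine c8.of_eq ?_ ?_
    · simp only [state, Sum.update_elim_inl, update_regs_ifl, update_regs_un, update_regs_cl, keptRev, if_true,
        List.nil_append]
      congr 1
      cases ρ; cases hc; simp_all
    · simp only [Sum.update_elim_inl, Sum.elim_inl, update_regs_ifl, update_regs_un, regs_un, regs_cl,
        List.length_append, length_encItem, List.length_reverse, decide_true]
      omega
  · -- the keys differ: re-push the entry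
    have c8 := c7.seq (runs_ifFlag_false (F := (Sum.inl K.ifl : K ⊕ AReg))
      ((clear (Sum.inl K.ifl) ;; clear (Sum.inl K.un)) ;; clear (Sum.inl K.cl)) (by simp [hkk])
      ((runs_repush (r := K.un) (by decide) false _).seq ((runs_pour (a := (Sum.inl K.cl : K ⊕ AReg))
        (b := Sum.inl K.lit) (by simp) _).seq (runs_repush (r := K.lit) (by decide) true _))))
    refine c8.of_eq ?_ ?_
    · simp only [state, Sum.elim_inl, Sum.update_elim_inl, regs_un, regs_mem2, update_regs_un, update_regs_mem2, regs_cl,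
        regs_lit, update_regs_cl, update_regs_lit, List.reverse_reverse, List.append_nil, keptRev, if_neg hkk,
        List.append_assoc]
      congr 1
      cases ρ; cases hc; simp_all
    · simp only [Sum.elim_inl, regs_un, regs_cl, regs_lit, Sum.update_elim_inl, update_regs_un, update_regs_mem2,
        update_regs_cl, update_regs_lit, regs_mem2, List.length_append, length_encItem, List.length_reverse,
        List.append_nil]
      omega

/-- `delEntry` keeps the scratch registers clean. [folklore] -/
theorem DClean.with_mem_mem2 {ρ : St} (h : DClean ρ) (m m2 : List Bool) : DClean { ρ with mem := m, mem2 := m2 } :=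
  ⟨h.lit, h.cl, h.incl, h.it1, h.it2, h.un, h.a0, h.ifl, h.tmp⟩

/-! ### The deletion pass -/

/-- The deletion pass: entry by entry (the popped first bit of each entry is pushed back before
`delEntry` reads it). [folklore] -/
def delLoop : Com (K ⊕ AReg) :=
  loop (Sum.inl K.mem) (push (Sum.inl K.mem) true ;; delEntry) (push (Sum.inl K.mem) false ;; delEntry)

/-- The code of an entry is never empty. [folklore] -/
theorem exists_entry_code_eq_cons (kk v : List Bool) :
    ∃ (c₀ : Bool) (crest : List Bool), encItem kk.reverse false ++ encItem v true = c₀ :: crest := by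
  cases h : encItem kk.reverse false ++ encItem v true with
  | nil => have := congrArg List.length h; simp at this
  | cons c₀ crest => exact ⟨_, _, rfl⟩

/-- Filtering a log shortens its code. [folklore] -/
theorem length_encLog_filter_le (p : List Bool × List Bool → Bool) :
    ∀ E : List (List Bool × List Bool), (encLog (E.filter p)).length ≤ (encLog E).length
  | [] => by simp
  | e :: E => by
    have ih := length_encLog_filter_le p E
    rw [List.filter_cons]
    split <;> simp [encLog_cons] <;> omega

/-- **The deletion pass.** From a file holding the log of `E`, the target `k` on `key` and clean
scratch, `delLoop` empties `mem` and leaves on `mem2` the reversed code of the entries of `E` whose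
key differs from `k` (in order), within `|E| · (26 |encLog E| + 60 β + 63) + 1` steps for a
`β`-bounded log and `|k| ≤ β`. [folklore] -/
theorem runs_delLoop (k : List Bool) (β : ℕ) (hk : k.length ≤ β) (x y z t u f g : List Bool) :
    ∀ (E : List (List Bool × List Bool)) (ρ : St), ρ.mem = encLog E → ρ.key = k → DClean ρ → BoundedLog β E →
    Runs delLoop (state ρ (AReg.file x y z [] t u f g))
      (state { ρ with mem := [], mem2 := (encLog (E.filter fun e => e.1 ≠ k)).reverse ++ ρ.mem2 }
        (AReg.file x y z [] t u f g))
      (E.length * (26 * (encLog E).length + 60 * β + 63) + 1)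
  | [], ρ, hmem, _, _, _ => by
    refine (Runs.loop_nil _ _ (by simp [state, hmem])).of_eq ?_ (by simp)
    simp only [state]
    congr 1
    cases ρ; simp only at hmem; simp [hmem]
  | (kk, v) :: E, ρ, hmem, hkey, hc, hE => by
    set F : Regs AReg := AReg.file x y z [] t u f g with hF
    have hb := hE (kk, v) (by simp)
    have hE' : BoundedLog β E := fun e he => hE e (by simp [he])
    obtain ⟨c₀, crest, hcode⟩ := exists_entry_code_eq_cons kk v
    have hmem' : ρ.mem = c₀ :: (crest ++ encLog E) := by
      rw [hmem, encLog_cons, ← List.cons_append, ← hcode]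
    have hk0 : state ρ F (Sum.inl K.mem) = c₀ :: (crest ++ encLog E) := by simp [state, hmem']
    have hpush : Runs (push (Sum.inl K.mem) c₀) (Function.update (state ρ F) (Sum.inl K.mem) (crest ++ encLog E))
        (state ρ F) 1 :=
      Runs.push' (by rw [Function.update_self, Function.update_idem, ← hk0, Function.update_eq_self])
    have hdel := runs_delEntry ρ x y z t u f g kk v k (encLog E) (by rw [hmem, encLog_cons]) hkey hc
    set ρ₁ : St := { ρ with mem := encLog E, mem2 := keptRev k kk v ++ ρ.mem2 } with hρ₁
    have ih := runs_delLoop k β hk x y z t u f g E ρ₁ rfl hkey (hc.with_mem_mem2 _ _) hE'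
    have hbody := hpush.seq hdel
    -- the final state and the cost, common to both values of the popped bit
    have hfin : ({ ρ₁ with mem := [], mem2 := (encLog (E.filter fun e => e.1 ≠ k)).reverse ++ ρ₁.mem2 } : St) =
        { ρ with mem := [], mem2 := (encLog (((kk, v) :: E).filter fun e => e.1 ≠ k)).reverse ++ ρ.mem2 } := by
      simp only [hρ₁, keptRev, List.filter_cons]
      by_cases hkk : kk = k
      · simp [hkk]
      · simp [hkk, List.reverse_append, List.append_assoc]
    set L := (encLog ((kk, v) :: E)).length with hL
    have hLE : (encLog E).length ≤ L := by simp [hL, encLog_cons]; omega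
    have hLc : (encItem kk.reverse false ++ encItem v true ++ encLog E).length = L := by
      simp [hL, encLog_cons, List.append_assoc]
    have hm : E.length * (26 * (encLog E).length + 60 * β + 63) ≤ E.length * (26 * L + 60 * β + 63) :=
      Nat.mul_le_mul_left _ (by omega)
    have hsucc : ((kk, v) :: E).length * (26 * L + 60 * β + 63) + 1 =
        (26 * L + 60 * β + 63) + (E.length * (26 * L + 60 * β + 63) + 1) := by
      rw [List.length_cons, Nat.succ_mul]; omega
    have hkk : kk.length ≤ β := hb.1
    have hv : v.length ≤ β := hb.2
    rw [hsucc]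
    rw [hLc] at hbody
    cases c₀
    · refine (Runs.loop_false hk0 hbody ih).of_eq (by rw [hfin]) ?_
      omega
    · refine (Runs.loop_true hk0 hbody ih).of_eq (by rw [hfin]) ?_
      omega

/-- `memDelete`: the deletion pass followed by one `pour` restoring the kept entries on `mem`, in
order and in format. [folklore] -/
def memDelete : Com (K ⊕ AReg) := delLoop ;; pour (Sum.inl K.mem2) (Sum.inl K.mem)

/-- **Deleting a key.** `mem := encLog (E.filter (key ≠ k))`, everything else restored, within
`|E| (26 |encLog E| + 60 β + 63) + 3 |encLog E| + 2` steps. [folklore] -/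
theorem runs_memDelete (ρ : St) (x y z t u f g : List Bool) (E : List (List Bool × List Bool)) (k : List Bool)
    (β : ℕ) (hk : k.length ≤ β) (hE : BoundedLog β E) (hmem : ρ.mem = encLog E) (hkey : ρ.key = k)
    (hmem2 : ρ.mem2 = []) (hc : DClean ρ) :
    Runs memDelete (state ρ (AReg.file x y z [] t u f g))
      (state { ρ with mem := encLog (E.filter fun e => e.1 ≠ k) } (AReg.file x y z [] t u f g))
      (E.length * (26 * (encLog E).length + 60 * β + 63) + 3 * (encLog E).length + 2) := by
  have h1 := runs_delLoop k β hk x y z t u f g E ρ hmem hkey hc hE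
  have h2 := h1.seq (runs_pour (a := (Sum.inl K.mem2 : K ⊕ AReg)) (b := Sum.inl K.mem) (by simp) _)
  simp only [state, Sum.elim_inl, regs_mem2, hmem2, List.append_nil, List.reverse_reverse, regs_mem,
    Sum.update_elim_inl, update_regs_mem2, update_regs_mem, List.length_reverse] at h2
  refine h2.of_eq ?_ ?_
  · simp only [state]
    congr 1
    cases ρ; simp only at hmem2; simp [hmem2]
  · have := length_encLog_filter_le (fun e => e.1 ≠ k) E
    omega

/-! ### Storing through the log -/

/-- `memStore`: delete every entry with the key held on `key`, then prepend the entry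
`(key, x)` (`memWrite`). [folklore] -/
def memStore : Com (K ⊕ AReg) := memDelete ;; memWrite

/-- The log after a store of `v` at key `k`. [folklore] -/
def storeLog (E : List (List Bool × List Bool)) (k v : List Bool) : List (List Bool × List Bool) :=
  (k, v) :: E.filter fun e => e.1 ≠ k

/-- A uniform bound of the cost of `memStore` on a log of at most `n` entries of code length at
most `L`, with `β`-bounded keys and values. [folklore] -/
def storeCostD (n L β : ℕ) : ℕ := n * (26 * L + 60 * β + 63) + 3 * L + 14 * β + 9

/-- `storeCostD` is monotone in the entry count and the code length. [folklore] -/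
theorem storeCostD_mono {n n' L L' : ℕ} (hn : n ≤ n') (hL : L ≤ L') (β : ℕ) :
    storeCostD n L β ≤ storeCostD n' L' β := by
  unfold storeCostD
  have := Nat.mul_le_mul hn (show 26 * L + 60 * β + 63 ≤ 26 * L' + 60 * β + 63 by omega)
  omega

/-- **Storing.** From a file holding the log of `E`, the key `k` on `key`, the value `v` on the
bank register `x`, clean scratch: `mem := encLog (storeLog E k v)`, `key` and `x` emptied, within
`storeCostD |E| |encLog E| β`. [folklore] -/
theorem runs_memStore (ρ : St) (v y z t u f g : List Bool) (E : List (List Bool × List Bool)) (k : List Bool)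
    (β : ℕ) (hk : k.length ≤ β) (hv : v.length ≤ β) (hE : BoundedLog β E) (hmem : ρ.mem = encLog E)
    (hkey : ρ.key = k) (hmem2 : ρ.mem2 = []) (hkey2 : ρ.key2 = []) (hc : DClean ρ) :
    Runs memStore (state ρ (AReg.file v y z [] t u f g))
      (state { ρ with mem := encLog (storeLog E k v), key := [] } (AReg.file [] y z [] t u f g))
      (storeCostD E.length (encLog E).length β) := by
  have h1 := runs_memDelete ρ v y z t u f g E k β hk hE hmem hkey hmem2 hc
  have h2 := h1.seq (runs_memWrite _ (E.filter fun e => e.1 ≠ k) k v y z [] t u f g rfl (by simp [hkey])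
    (by simp [hkey2]))
  refine h2.of_eq ?_ ?_
  · simp only [state, storeLog]
    congr 1
    cases ρ; simp only at hkey2; simp [hkey2]
  · unfold storeCostD; omega

/-! ### The invariants maintained by `memStore` -/

/-- Deleting a key does not change the lookup of the other keys. [folklore] -/
theorem logLookup_filter_ne {k k' : List Bool} (h : k' ≠ k) :
    ∀ E : List (List Bool × List Bool), logLookup (E.filter fun e => e.1 ≠ k) k' = logLookup E k'
  | [] => rfl
  | e :: E => by
    have ih := logLookup_filter_ne h E
    by_cases hek : e.1 = k
    · have hne : e.1 ≠ k' := fun h' => h (h'.symm.trans hek)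
      rw [List.filter_cons_of_neg (by simp [hek]), ih, logLookup, if_neg hne]
    · rw [List.filter_cons_of_pos (by simp [hek])]
      simp only [logLookup, ih]

/-- Lookup after a store. [folklore] -/
theorem logLookup_storeLog (E : List (List Bool × List Bool)) (k v k' : List Bool) :
    logLookup (storeLog E k v) k' = if k = k' then v else logLookup E k' := by
  unfold storeLog
  simp only [logLookup]
  split_ifs with h
  · rfl
  · exact logLookup_filter_ne (Ne.symm h) E

/-- **A store represents `Function.update`.** [folklore] -/
theorem Represents.store {E : List (List Bool × List Bool)} {mem : ℕ → ℕ} (h : Represents E mem) (a v : ℕ) :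
    Represents (storeLog E (encodeNat a) (encodeNat v)) (Function.update mem a v) := by
  intro b
  rw [logLookup_storeLog]
  by_cases hab : a = b
  · subst hab; simp
  · rw [if_neg (mt encodeNat_eq_encodeNat_iff.1 hab), Function.update_of_ne (Ne.symm hab), h b]

/-- A store keeps the keys pairwise distinct. [folklore] -/
theorem nodup_keys_storeLog {E : List (List Bool × List Bool)} (h : (E.map Prod.fst).Nodup) (k v : List Bool) :
    ((storeLog E k v).map Prod.fst).Nodup := by
  unfold storeLog
  rw [List.map_cons, List.nodup_cons]
  refine ⟨fun hm => ?_, ?_⟩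
  · obtain ⟨e, he, hek⟩ := List.mem_map.1 hm
    rw [List.mem_filter] at he
    exact absurd hek (by simpa using he.2)
  · have : (E.filter fun e => e.1 ≠ k).map Prod.fst = (E.map Prod.fst).filter fun a => a ≠ k := by
      rw [List.filter_map]; rfl
    rw [this]
    exact h.filter _

/-- A store keeps the log bounded. [folklore] -/
theorem BoundedLog.storeLog {β : ℕ} {E : List (List Bool × List Bool)} (h : BoundedLog β E) {k v : List Bool}
    (hk : k.length ≤ β) (hv : v.length ≤ β) : BoundedLog β (storeLog E k v) := by
  intro e he
  unfold ToTM2.storeLog at he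
  rcases List.mem_cons.1 he with rfl | he
  · exact ⟨hk, hv⟩
  · exact h e (List.mem_of_mem_filter he)

/-- A store adds at most one entry. [folklore] -/
theorem length_storeLog_le (E : List (List Bool × List Bool)) (k v : List Bool) :
    (storeLog E k v).length ≤ E.length + 1 := by
  unfold storeLog
  have := List.length_filter_le (fun e => e.1 ≠ k) E
  simp only [List.length_cons]
  omega

/-- `KeysBelow A E`: every key of the log is the numeral of an address `≤ A`. [folklore] -/
def KeysBelow (A : ℕ) (E : List (List Bool × List Bool)) : Prop :=
  ∀ e ∈ E, ∃ a, a ≤ A ∧ e.1 = encodeNat a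

/-- A store at an address `≤ A` keeps the keys below `A`. [folklore] -/
theorem KeysBelow.storeLog {A : ℕ} {E : List (List Bool × List Bool)} (h : KeysBelow A E) {a : ℕ} (ha : a ≤ A)
    (v : List Bool) : KeysBelow A (storeLog E (encodeNat a) v) := by
  intro e he
  unfold ToTM2.storeLog at he
  rcases List.mem_cons.1 he with rfl | he
  · exact ⟨a, ha, rfl⟩
  · exact h e (List.mem_of_mem_filter he)

/-- `KeysBelow` is monotone in the bound. [folklore] -/
theorem KeysBelow.mono {A A' : ℕ} {E : List (List Bool × List Bool)} (h : KeysBelow A E) (hA : A ≤ A') :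
    KeysBelow A' E := fun e he => by
  obtain ⟨a, ha, hea⟩ := h e he
  exact ⟨a, ha.trans hA, hea⟩

/-- **A log with pairwise distinct keys below `A` has at most `A + 1` entries.** [folklore] -/
theorem length_le_of_nodup_keysBelow {A : ℕ} {E : List (List Bool × List Bool)} (hnd : (E.map Prod.fst).Nodup)
    (hb : KeysBelow A E) : E.length ≤ A + 1 := by
  have hsub : E.map Prod.fst ⊆ (List.range (A + 1)).map encodeNat := by
    intro x hx
    obtain ⟨e, he, rfl⟩ := List.mem_map.1 hx
    obtain ⟨a, ha, hea⟩ := hb e he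
    exact List.mem_map.2 ⟨a, List.mem_range.2 (Nat.lt_succ_of_le ha), hea.symm⟩
  have := (List.subperm_of_subset hnd hsub).length_le
  simpa using this

/-! ### Reading a memory segment into an item list

The `query` instruction of the word RAM hands the oracle a memory segment. The simulating machine
first collects the segment as a list of items (canonical numerals, sign `true`) on the register
`nrev`, reading the cells one by one through `memRead` while a unary counter runs down. -/

/-- The items of a word list: each word as a canonical numeral with sign `true`, first word on top.
[folklore] -/
def valItems (ws : List ℕ) : List Bool := encItems (ws.map fun w => (encodeNat w, true))

/-- `valItems` of no word. [folklore] -/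
@[simp] theorem valItems_nil : valItems [] = [] := rfl

/-- `valItems` of a cons. [folklore] -/
@[simp] theorem valItems_cons (w : ℕ) (ws : List ℕ) : valItems (w :: ws) = encItem (encodeNat w) true ++ valItems ws := rfl

/-- `valItems` of an append. [folklore] -/
theorem valItems_append (us vs : List ℕ) : valItems (us ++ vs) = valItems us ++ valItems vs := by
  simp [valItems, encItems_append]

/-- The item list of words with `β`-bit numerals has length at most `|ws| (2β + 2)`. [folklore] -/
theorem length_valItems_le {β : ℕ} : ∀ ws : List ℕ, (∀ w ∈ ws, (encodeNat w).length ≤ β) →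
    (valItems ws).length ≤ ws.length * (2 * β + 2)
  | [], _ => by simp
  | w :: ws, h => by
    have h1 := h w (by simp)
    have h2 := length_valItems_le ws fun w' hw' => h w' (by simp [hw'])
    have e : (ws.length + 1) * (2 * β + 2) = ws.length * (2 * β + 2) + (2 * β + 2) := by ring
    rw [valItems_cons, List.length_append, length_encItem, List.length_cons, e]
    omega

/-- One more cell of a segment, read first. [folklore] -/
theorem readSeg_succ (mem : ℕ → ℕ) (a n : ℕ) : readSeg mem a (n + 1) = mem a :: readSeg mem (a + 1) n := by
  simp only [readSeg, List.range_succ_eq_map, List.map_cons, Nat.add_zero, List.map_map, List.cons.injEq, true_and]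
  refine List.map_congr_left fun i _ => ?_
  simp only [Function.comp_apply]; congr 1; omega

/-- Every word of a segment is a memory value. [folklore] -/
theorem mem_readSeg_iff {mem : ℕ → ℕ} {a n w : ℕ} : w ∈ readSeg mem a n ↔ ∃ i < n, mem (a + i) = w := by
  simp [readSeg]

/-- `readBody`: read the cell addressed by the numeral on the bank register `x` (one `memRead` on a
copy of the address) and push its numeral as an item onto `nrev`; then advance the address. [folklore] -/
def readBody : Com (K ⊕ AReg) :=
  (((copy (Sum.inr AReg.x) (Sum.inl K.key) (Sum.inl K.tmp) (Sum.inr AReg.s) ;; memRead) ;; clear (Sum.inl K.key)) ;;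
    pushItemG (Sum.inl K.val) (Sum.inl K.nrev) true) ;;
  incr (Sum.inr AReg.x) (Sum.inr AReg.s) (Sum.inr AReg.t) (Sum.inr AReg.f)

/-- `RClean ρ E`: the log of `E` on `mem` and the registers of `memRead`, of the copies and of the
item push all clean. [folklore] -/
structure RClean (ρ : St) (E : List (List Bool × List Bool)) : Prop where
  mem : ρ.mem = encLog E
  mem2 : ρ.mem2 = []
  key : ρ.key = []
  key2 : ρ.key2 = []
  val : ρ.val = []
  st1 : ρ.st1 = []
  st2 : ρ.st2 = []
  ph : ρ.ph = []
  eqf : ρ.eqf = []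
  found : ρ.found = []
  tmp : ρ.tmp = []

/-- Changing `nrev` and `cn` keeps a file `RClean`. [folklore] -/
theorem RClean.with_nrev_cn {ρ : St} {E : List (List Bool × List Bool)} (h : RClean ρ E) (v c : List Bool) :
    RClean { ρ with nrev := v, cn := c } E :=
  ⟨h.mem, h.mem2, h.key, h.key2, h.val, h.st1, h.st2, h.ph, h.eqf, h.found, h.tmp⟩

/-- **One cell.** From an address `a` on `x` (numeral of at most `γ` bits, `a + 1` too) and a
`β`-bounded log representing `mem` (`β ≤ γ`), `readBody` pushes the item of `mem a` on `nrev` and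
leaves `a + 1` on `x`, within `|encLog E| (3γ + 17) + 25 γ + 30` steps. [folklore] -/
theorem runs_readBody {ρ : St} {E : List (List Bool × List Bool)} (h : RClean ρ E) {mem : ℕ → ℕ}
    (hrep : Represents E mem) {β γ : ℕ} (hE : BoundedLog β E) (hβγ : β ≤ γ) (a : ℕ)
    (ha : (encodeNat a).length ≤ γ) (y z u g : List Bool) :
    Runs readBody (state ρ (AReg.file (encodeNat a) y z [] [] u [] g))
      (state { ρ with nrev := encItem (encodeNat (mem a)) true ++ ρ.nrev } (AReg.file (encodeNat (a + 1)) y z [] [] u [] g))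
      ((encLog E).length * (3 * γ + 17) + 25 * γ + 30) := by
  have lval : (encodeNat (mem a)).length ≤ β := by
    have := hE.length_logLookup_le (encodeNat a); rwa [hrep.lookup a] at this
  have c1 := runs_copy (a := (Sum.inr AReg.x : K ⊕ AReg)) (b := Sum.inl K.key) (t := Sum.inl K.tmp) (u := Sum.inr AReg.s)
    (by simp) (by simp) (by simp) (by simp) (by simp) (by simp) (state ρ (AReg.file (encodeNat a) y z [] [] u [] g))
    (by simp [state, h.tmp]) (by simp [state])
  simp only [state, Sum.elim_inr, AReg.file_x, Sum.elim_inl, regs_key, h.key, List.append_nil, Sum.update_elim_inl,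
    update_regs_key] at c1
  have c2 := c1.seq (runs_memRead _ _ E (encodeNat a) (by simp [h.mem]) rfl (by simp [h.mem2]) (by simp [h.key2])
    (by simp [h.val]) (by simp [h.st1]) (by simp [h.st2]) (by simp [h.ph]) (by simp [h.eqf]) (by simp [h.found]))
  have c3 := c2.seq (runs_clear (Sum.inl K.key : K ⊕ AReg) _)
  simp only [state, Sum.elim_inl, regs_key, Sum.update_elim_inl, update_regs_key, hrep.lookup a] at c3
  have c4 := c3.seq (runs_pushItemG (src := (Sum.inl K.val : K ⊕ AReg)) (dst := Sum.inl K.nrev) (by simp) true _)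
  simp only [Sum.elim_inl, regs_val, regs_nrev, Sum.update_elim_inl, update_regs_val, update_regs_nrev] at c4
  have c5 := c4.seq (runs_incr (B := (Sum.inr AReg.x : K ⊕ AReg)) (t := Sum.inr AReg.s) (t2 := Sum.inr AReg.t)
    (fl := Sum.inr AReg.f) (by simp) (by simp) (by simp) (by simp) (by simp) (by simp) _ (by simp) (by simp) (by simp))
  simp only [Sum.elim_inr, AReg.file_x, Sum.update_elim_inr, AReg.update_file_x,
    ← TokConv.encodeNat_succ_eq_incRes] at c5
  refine c5.of_eq ?_ ?_
  · simp only [state]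
    congr 1
    cases ρ; cases h; simp_all
  · have l1 : (encodeNat a).length * 7 ≤ 7 * γ := by omega
    nlinarith [lval, ha, hβγ, Nat.zero_le (encLog E).length]

/-- `readLoop`: `readBody` once per unit of the counter `cn`. [folklore] -/
def readLoop : Com (K ⊕ AReg) := loop (Sum.inl K.cn) readBody readBody

/-- **A segment.** With `1^n` on `cn` and the address `a` on `x` (all addresses up to `a + n` having
numerals of at most `γ` bits), `readLoop` pushes the items of the segment `readSeg mem a n`, last
cell on top, onto `nrev`, leaves `a + n` on `x` and empties `cn`. [folklore] -/
theorem runs_readLoop {E : List (List Bool × List Bool)} {mem : ℕ → ℕ} (hrep : Represents E mem) {β γ : ℕ}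
    (hE : BoundedLog β E) (hβγ : β ≤ γ) (y z u g : List Bool) :
    ∀ (n a : ℕ) (ρ : St), RClean ρ E → ρ.cn = ones n → (encodeNat (a + n)).length ≤ γ →
    Runs readLoop (state ρ (AReg.file (encodeNat a) y z [] [] u [] g))
      (state { ρ with nrev := valItems (readSeg mem a n).reverse ++ ρ.nrev, cn := [] }
        (AReg.file (encodeNat (a + n)) y z [] [] u [] g))
      (n * ((encLog E).length * (3 * γ + 17) + 25 * γ + 32) + 1)
  | 0, a, ρ, _, hcn, _ => by
    refine (Runs.loop_nil _ _ (by simp [state, hcn])).of_eq ?_ (by simp)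
    simp only [state, readSeg, List.range_zero, List.map_nil, List.reverse_nil, valItems_nil, List.nil_append,
      Nat.add_zero]
    congr 1
    cases ρ; simp only at hcn; simp [hcn]
  | n + 1, a, ρ, h, hcn, hγ => by
    have ha : (encodeNat a).length ≤ γ := le_trans (Brick.length_encodeNat_mono (by omega)) hγ
    have hk : state ρ (AReg.file (encodeNat a) y z [] [] u [] g) (Sum.inl K.cn) = true :: ones n := by
      simp [state, hcn, ones, List.replicate_succ]
    set ρ₀ : St := { ρ with cn := ones n } with hρ₀
    have hupd : Function.update (state ρ (AReg.file (encodeNat a) y z [] [] u [] g)) (Sum.inl K.cn) (ones n) =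
        state ρ₀ (AReg.file (encodeNat a) y z [] [] u [] g) := by simp [state, hρ₀]
    have hbody := runs_readBody (ρ := ρ₀) (h.with_nrev_cn ρ.nrev (ones n) |>.1 |> fun _ => ⟨h.mem, h.mem2, h.key, h.key2,
      h.val, h.st1, h.st2, h.ph, h.eqf, h.found, h.tmp⟩) hrep hE hβγ a ha y z u g
    set ρ₁ : St := { ρ₀ with nrev := encItem (encodeNat (mem a)) true ++ ρ₀.nrev } with hρ₁
    have ih := runs_readLoop hrep hE hβγ y z u g n (a + 1) ρ₁ ⟨h.mem, h.mem2, h.key, h.key2, h.val, h.st1, h.st2, h.ph,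
      h.eqf, h.found, h.tmp⟩ rfl (by rw [show a + 1 + n = a + (n + 1) by omega]; exact hγ)
    refine (Runs.loop_true' hk hupd hbody ih).of_eq ?_ ?_
    · rw [show a + 1 + n = a + (n + 1) by omega]
      simp only [state, hρ₁, hρ₀, readSeg_succ, List.reverse_cons, valItems_append, valItems_cons, valItems_nil,
        List.append_nil, List.append_assoc]
    · have e : (n + 1) * ((encLog E).length * (3 * γ + 17) + 25 * γ + 32) =
          n * ((encLog E).length * (3 * γ + 17) + 25 * γ + 32) + ((encLog E).length * (3 * γ + 17) + 25 * γ + 32) := by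
        ring
      rw [e]; omega

/-! ### Deciding 3SUM on the item list by brute force

The zig-zag decoding `Equiv.intEquivNat.symm` reads an even word `2v` as `v` and an odd word
`2v + 1` as `-(v + 1)`. Three words sum to zero as integers iff the sum of their *positive parts*
(`posPart`) equals the sum of their *negative parts* (`negPart`), two natural numbers which the
machine accumulates on `mc` and `tokc` by reading the parity bit of each numeral. -/

/-- The positive part of the zig-zag decoding of `w`: `w / 2` for even `w`, else `0`. [folklore] -/
def posPart (w : ℕ) : ℕ := if w % 2 = 0 then w / 2 else 0

/-- The negative part of the zig-zag decoding of `w`: `w / 2 + 1` for odd `w`, else `0`. [folklore] -/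
def negPart (w : ℕ) : ℕ := if w % 2 = 1 then w / 2 + 1 else 0

/-- The zero-sum test of three words in terms of positive and negative parts. [folklore] -/
def tst (u v w : ℕ) : Bool := decide (posPart u + posPart v + posPart w = negPart u + negPart v + negPart w)

/-- Accumulating the positive part, on bit strings: for an even nonzero word (low bit `0`) add the
high bits. [folklore] -/
def accP (p : List Bool) : List Bool → List Bool
  | false :: r => addRes p r
  | _ => p

/-- Accumulating the negative part, on bit strings: for an odd word (low bit `1`) add the high bits
plus one. [folklore] -/
def accN (q : List Bool) : List Bool → List Bool
  | true :: r => addRes q (incRes true r)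
  | _ => q

/-- A word in terms of the shape of its numeral. [folklore] -/
theorem eq_of_encodeNat_eq_cons {w : ℕ} {b : Bool} {r : List Bool} (h : encodeNat w = b :: r) :
    w = b.toNat + 2 * bitsToNat r := by
  have := bitsToNat_encodeNat w
  rw [h, bitsToNat_cons] at this
  exact this.symm

/-- `accP` adds the positive part. [folklore] -/
theorem bitsToNat_accP (p : List Bool) (w : ℕ) : bitsToNat (accP p (encodeNat w)) = bitsToNat p + posPart w := by
  rcases h : encodeNat w with _ | ⟨_ | _, r⟩
  · have : w = 0 := eq_zero_of_encodeNat_eq_nil h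
    subst this
    simp [accP, posPart]
  · have hw := eq_of_encodeNat_eq_cons h
    simp only [accP, bitsToNat_addRes, posPart, Bool.toNat_false] at hw ⊢
    rw [if_pos (by omega)]
    omega
  · have hw := eq_of_encodeNat_eq_cons h
    simp only [accP, posPart, Bool.toNat_true] at hw ⊢
    rw [if_neg (by omega)]
    rfl

/-- `accN` adds the negative part. [folklore] -/
theorem bitsToNat_accN (q : List Bool) (w : ℕ) : bitsToNat (accN q (encodeNat w)) = bitsToNat q + negPart w := by
  rcases h : encodeNat w with _ | ⟨_ | _, r⟩
  · have : w = 0 := eq_zero_of_encodeNat_eq_nil h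
    subst this
    simp [accN, negPart]
  · have hw := eq_of_encodeNat_eq_cons h
    simp only [accN, negPart, Bool.toNat_false] at hw ⊢
    rw [if_neg (by omega)]
    rfl
  · have hw := eq_of_encodeNat_eq_cons h
    simp only [accN, bitsToNat_addRes, bitsToNat_incRes, negPart, Bool.toNat_true] at hw ⊢
    rw [if_pos (by omega)]
    omega

/-- `accP` lengthens by at most one bit beyond its arguments. [folklore] -/
theorem length_accP_le (p wv : List Bool) : (accP p wv).length ≤ max p.length wv.length + 1 := by
  rcases wv with _ | ⟨_ | _, r⟩
  · simp [accP]
  · have := length_addRes_le_max p r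
    simp only [accP, List.length_cons]
    omega
  · simp [accP]; omega

/-- `accN` lengthens by at most one bit beyond its arguments. [folklore] -/
theorem length_accN_le (q wv : List Bool) : (accN q wv).length ≤ max q.length wv.length + 1 := by
  rcases wv with _ | ⟨_ | _, r⟩
  · simp [accN]
  · simp [accN]; omega
  · have h1 := length_addRes_le_max q (incRes true r)
    have h2 := length_incRes_le true r
    simp only [accN, List.length_cons]
    omega

/-- The odd branch of `accum`: `tokc := tokc + (y + 1)` through the bank. [folklore] -/
def accumOdd : Com (K ⊕ AReg) :=
  (((incr (Sum.inr AReg.y) (Sum.inr AReg.s) (Sum.inr AReg.t) (Sum.inr AReg.f) ;;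
      move (Sum.inl K.tokc) (Sum.inr AReg.x) (Sum.inl K.tmp)) ;; bk add) ;; clear (Sum.inr AReg.y)) ;;
    move (Sum.inr AReg.x) (Sum.inl K.tokc) (Sum.inl K.tmp)

/-- The even branch of `accum`: `mc := mc + y` through the bank. [folklore] -/
def accumEven : Com (K ⊕ AReg) :=
  ((move (Sum.inl K.mc) (Sum.inr AReg.x) (Sum.inl K.tmp) ;; bk add) ;; clear (Sum.inr AReg.y)) ;;
    move (Sum.inr AReg.x) (Sum.inl K.mc) (Sum.inl K.tmp)

/-- `accum A`: accumulate the word held (as a canonical numeral) on the register `A` into the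
positive part on `mc` or the negative part on `tokc`, according to its low bit (on a copy popped
into the bank register `y`; the addition is the bank's `add`). [folklore] -/
def accum (A : K) : Com (K ⊕ AReg) :=
  copy (Sum.inl A) (Sum.inr AReg.y) (Sum.inl K.tmp) (Sum.inr AReg.s) ;; pop (Sum.inr AReg.y) accumOdd accumEven skip

/-- **Accumulating one word** (`A ≠ tmp` holding `wv`, parts `pP`, `pN` on `mc`, `tokc`,
all of length `≤ m`, empty bank and `tmp`): `mc := accP pP wv`, `tokc := accN pN wv`, within
`60 m + 63` steps. [folklore] -/
theorem runs_accum {A : K} (hA3 : A ≠ K.tmp) (ρ : St) {wv pP pN : List Bool}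
    {m : ℕ} (hA : ρ.regs A = wv) (hmc : ρ.mc = pP) (htokc : ρ.tokc = pN) (htmp : ρ.tmp = [])
    (hwv : wv.length ≤ m) (hP : pP.length ≤ m) (hN : pN.length ≤ m) :
    Runs (accum A) (state ρ F0) (state { ρ with mc := accP pP wv, tokc := accN pN wv } F0) (60 * m + 63) := by
  have c1 := runs_copy (a := (Sum.inl A : K ⊕ AReg)) (b := Sum.inr AReg.y) (t := Sum.inl K.tmp) (u := Sum.inr AReg.s)
    (by simp) (by simp [hA3]) (by simp) (by simp) (by simp) (by simp) (state ρ F0) (by simp [state, htmp]) (by simp [state])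
  simp only [state, Sum.elim_inl, hA, Sum.elim_inr, AReg.file_y, List.append_nil, Sum.update_elim_inr,
    AReg.update_file_y] at c1
  rcases wv with _ | ⟨_ | _, r⟩
  · -- the word `0`: nothing to add
    have c2 := c1.seq (Runs.pop_nil (k := (Sum.inr AReg.y : K ⊕ AReg)) accumOdd accumEven (by simp) (Runs.skip _))
    refine c2.of_eq ?_ (by simp)
    simp only [state, accP, accN]
    congr 1
    cases ρ; simp only at hmc htokc; simp [hmc, htokc]
  · -- low bit `0`: positive part
    simp only [List.length_cons] at hwv
    have d1 := runs_move (a := (Sum.inl K.mc : K ⊕ AReg)) (b := Sum.inr AReg.x) (t := Sum.inl K.tmp) (by simp) (by simp)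
      (by simp) (state ρ (AReg.file [] r [] [] [] [] [] [])) (by simp [state, htmp])
    simp only [state, Sum.elim_inl, regs_mc, hmc, Sum.elim_inr, AReg.file_x, List.append_nil, Sum.update_elim_inl,
      update_regs_mc, Sum.update_elim_inr, AReg.update_file_x] at d1
    have d2 := d1.seq ((runs_add pP r [] [] []).inr _)
    have d3 := d2.seq (runs_clear (Sum.inr AReg.y : K ⊕ AReg) _)
    simp only [Sum.elim_inr, AReg.file_y, Sum.update_elim_inr, AReg.update_file_y] at d3
    have d4 := d3.seq (runs_move (a := (Sum.inr AReg.x : K ⊕ AReg)) (b := Sum.inl K.mc) (t := Sum.inl K.tmp) (by simp)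
      (by simp) (by simp) _ (by simp [htmp]))
    simp only [Sum.elim_inr, AReg.file_x, Sum.elim_inl, regs_mc, List.append_nil, Sum.update_elim_inr,
      AReg.update_file_x, Sum.update_elim_inl, update_regs_mc] at d4
    have c2 := c1.seq (Runs.pop_false' (k := (Sum.inr AReg.y : K ⊕ AReg)) accumOdd skip (w := r) (by simp) (by simp) d4)
    refine c2.of_eq ?_ ?_
    · simp only [state, accP, accN]
      congr 1
      cases ρ; simp only at htokc; simp [htokc]
    · have l1 := length_addRes_le_max pP r
      simp only [List.length_cons]
      omega
  · -- low bit `1`: negative part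
    simp only [List.length_cons] at hwv
    have d0 := runs_incr (B := (Sum.inr AReg.y : K ⊕ AReg)) (t := Sum.inr AReg.s) (t2 := Sum.inr AReg.t)
      (fl := Sum.inr AReg.f) (by simp) (by simp) (by simp) (by simp) (by simp) (by simp)
      (state ρ (AReg.file [] r [] [] [] [] [] [])) (by simp) (by simp) (by simp)
    simp only [state, Sum.elim_inr, AReg.file_y, Sum.update_elim_inr, AReg.update_file_y] at d0
    have d1 := d0.seq (runs_move (a := (Sum.inl K.tokc : K ⊕ AReg)) (b := Sum.inr AReg.x) (t := Sum.inl K.tmp) (by simp)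
      (by simp) (by simp) _ (by simp [htmp]))
    simp only [Sum.elim_inl, regs_tokc, htokc, Sum.elim_inr, AReg.file_x, List.append_nil, Sum.update_elim_inl,
      update_regs_tokc, Sum.update_elim_inr, AReg.update_file_x] at d1
    have d2 := d1.seq ((runs_add pN (incRes true r) [] [] []).inr _)
    have d3 := d2.seq (runs_clear (Sum.inr AReg.y : K ⊕ AReg) _)
    simp only [Sum.elim_inr, AReg.file_y, Sum.update_elim_inr, AReg.update_file_y] at d3
    have d4 := d3.seq (runs_move (a := (Sum.inr AReg.x : K ⊕ AReg)) (b := Sum.inl K.tokc) (t := Sum.inl K.tmp) (by simp)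
      (by simp) (by simp) _ (by simp [htmp]))
    simp only [Sum.elim_inr, AReg.file_x, Sum.elim_inl, regs_tokc, List.append_nil, Sum.update_elim_inr,
      AReg.update_file_x, Sum.update_elim_inl, update_regs_tokc] at d4
    have c2 := c1.seq (Runs.pop_true' (k := (Sum.inr AReg.y : K ⊕ AReg)) accumEven skip (w := r) (by simp) (by simp) d4)
    refine c2.of_eq ?_ ?_
    · simp only [state, accP, accN]
      congr 1
      cases ρ; simp only at hmc; simp [hmc]
    · have l1 := length_addRes_le_max pN (incRes true r)
      have l2 := length_incRes_le true r
      simp only [List.length_cons]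
      omega

/-- `finish`: normalise both parts, compare them (`eqW`), and raise the flag `he` if they agree;
`mc`, `tokc` end empty. [folklore] -/
def finish : Com (K ⊕ AReg) :=
  ((((((move (Sum.inl K.tokc) (Sum.inr AReg.x) (Sum.inl K.tmp) ;; bk normalize) ;;
      move (Sum.inr AReg.x) (Sum.inl K.tokc) (Sum.inl K.tmp)) ;; move (Sum.inl K.mc) (Sum.inr AReg.x) (Sum.inl K.tmp)) ;;
      bk normalize) ;; move (Sum.inl K.tokc) (Sum.inr AReg.y) (Sum.inl K.tmp)) ;; eqW) ;;
  pop (Sum.inr AReg.x) (clear (Sum.inl K.he) ;; push (Sum.inl K.he) true) skip skip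

/-- **Comparing the parts.** From parts `pP`, `pN` (of length `≤ m`) on `mc`, `tokc` and a flag `e`
on `he`: `he := flag (e || (val pP = val pN))`, `mc`, `tokc` emptied, within `60 m + 40` steps.
[folklore] -/
theorem runs_finish (ρ : St) {pP pN : List Bool} {e : Bool} {m : ℕ} (hmc : ρ.mc = pP) (htokc : ρ.tokc = pN)
    (hhe : ρ.he = flag e) (htmp : ρ.tmp = []) (hP : pP.length ≤ m) (hN : pN.length ≤ m) :
    Runs finish (state ρ F0)
      (state { ρ with mc := [], tokc := [], he := flag (e || decide (bitsToNat pP = bitsToNat pN)) } F0) (60 * m + 40) := by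
  have lP : (encodeNat (bitsToNat pP)).length ≤ m := by rw [← norm_eq_encodeNat]; exact (length_norm_le pP).trans hP
  have lN : (encodeNat (bitsToNat pN)).length ≤ m := by rw [← norm_eq_encodeNat]; exact (length_norm_le pN).trans hN
  have c1 := runs_move (a := (Sum.inl K.tokc : K ⊕ AReg)) (b := Sum.inr AReg.x) (t := Sum.inl K.tmp) (by simp) (by simp)
    (by simp) (state ρ F0) (by simp [state, htmp])
  simp only [state, Sum.elim_inl, regs_tokc, htokc, Sum.elim_inr, AReg.file_x, List.append_nil, Sum.update_elim_inl,
    update_regs_tokc, Sum.update_elim_inr, AReg.update_file_x] at c1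
  have c2 := c1.seq ((runs_normalize pN [] [] [] [] []).inr _)
  have c3 := c2.seq (runs_move (a := (Sum.inr AReg.x : K ⊕ AReg)) (b := Sum.inl K.tokc) (t := Sum.inl K.tmp) (by simp)
    (by simp) (by simp) _ (by simp [htmp]))
  simp only [Sum.elim_inr, AReg.file_x, Sum.elim_inl, regs_tokc, List.append_nil, Sum.update_elim_inr,
    AReg.update_file_x, Sum.update_elim_inl, update_regs_tokc] at c3
  have c4 := c3.seq (runs_move (a := (Sum.inl K.mc : K ⊕ AReg)) (b := Sum.inr AReg.x) (t := Sum.inl K.tmp) (by simp)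
    (by simp) (by simp) _ (by simp [htmp]))
  simp only [Sum.elim_inl, regs_mc, hmc, Sum.elim_inr, AReg.file_x, List.append_nil, Sum.update_elim_inl,
    update_regs_mc, Sum.update_elim_inr, AReg.update_file_x] at c4
  have c5 := c4.seq ((runs_normalize pP [] [] [] [] []).inr _)
  have c6 := c5.seq (runs_move (a := (Sum.inl K.tokc : K ⊕ AReg)) (b := Sum.inr AReg.y) (t := Sum.inl K.tmp) (by simp)
    (by simp) (by simp) _ (by simp [htmp]))
  simp only [Sum.elim_inl, regs_tokc, Sum.elim_inr, AReg.file_y, List.append_nil, Sum.update_elim_inl,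
    update_regs_tokc, Sum.update_elim_inr, AReg.update_file_y, norm_eq_encodeNat] at c6
  have c7 := c6.seq (runs_eqW _ (bitsToNat pP) (bitsToNat pN))
  by_cases hq : bitsToNat pP = bitsToNat pN
  · rw [if_pos hq, show encodeNat 1 = [true] by decide] at c7
    have c8 := c7.seq (Runs.pop_true' (k := (Sum.inr AReg.x : K ⊕ AReg)) skip skip (w := []) (by simp) rfl
      ((runs_clear_flag (Sum.inl K.he : K ⊕ AReg) (by simp [hhe, length_flag_le])).seq (Runs.push (Sum.inl K.he) true _)))
    refine c8.of_eq ?_ ?_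
    · simp only [Sum.update_elim_inr, AReg.update_file_x, Sum.update_elim_inl, update_regs_he, Sum.elim_inl, regs_he,
        state, hq, decide_true, Bool.or_true, flag_true]
    · omega
  · rw [if_neg hq, show encodeNat 0 = [] by decide] at c7
    have c8 := c7.seq (Runs.pop_nil (k := (Sum.inr AReg.x : K ⊕ AReg)) (clear (Sum.inl K.he) ;; push (Sum.inl K.he) true)
      skip (by simp) (Runs.skip _))
    refine c8.of_eq ?_ ?_
    · simp only [state, hq, decide_false, Bool.or_false]
      congr 1
      cases ρ; simp only at hhe; simp [hhe]
    · omega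

/-- `test3`: accumulate the three words on `adr`, `a0`, `cl`, then compare the parts. [folklore] -/
def test3 : Com (K ⊕ AReg) := ((accum K.adr ;; accum K.a0) ;; accum K.cl) ;; finish

/-- The cost of `test3` on words of at most `β` bits. [folklore] -/
def T3 (β : ℕ) : ℕ := 240 * β + 589

/-- **Testing one triple.** With the words `u`, `v`, `w` (numerals of at most `β` bits) on `adr`,
`a0`, `cl`, empty parts and a flag `e` on `he`: `he := flag (e || tst u v w)`, everything else
unchanged, within `T3 β` steps. [folklore] -/
theorem runs_test3 (ρ : St) {u v w : ℕ} {e : Bool} {β : ℕ} (hadr : ρ.adr = encodeNat u) (ha0 : ρ.a0 = encodeNat v)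
    (hcl : ρ.cl = encodeNat w) (hmc : ρ.mc = []) (htokc : ρ.tokc = []) (hhe : ρ.he = flag e) (htmp : ρ.tmp = [])
    (hu : (encodeNat u).length ≤ β) (hv : (encodeNat v).length ≤ β) (hw : (encodeNat w).length ≤ β) :
    Runs test3 (state ρ F0) (state { ρ with he := flag (e || tst u v w) } F0) (T3 β) := by
  have c1 := runs_accum (A := K.adr) (by decide) ρ (m := β) (by simp [hadr]) hmc htokc htmp hu (by simp) (by simp)
  have l1P := length_accP_le [] (encodeNat u)
  have l1N := length_accN_le [] (encodeNat u)
  simp only [List.length_nil, Nat.zero_max] at l1P l1N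
  have c2 := c1.seq (runs_accum (A := K.a0) (by decide) _ (wv := encodeNat v) (pP := accP [] (encodeNat u))
    (pN := accN [] (encodeNat u)) (m := β + 1) (by simp [ha0]) rfl rfl (by simp [htmp]) (by omega) (by omega) (by omega))
  have l2P := length_accP_le (accP [] (encodeNat u)) (encodeNat v)
  have l2N := length_accN_le (accN [] (encodeNat u)) (encodeNat v)
  have c3 := c2.seq (runs_accum (A := K.cl) (by decide) _ (wv := encodeNat w)
    (pP := accP (accP [] (encodeNat u)) (encodeNat v)) (pN := accN (accN [] (encodeNat u)) (encodeNat v)) (m := β + 2)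
    (by simp [hcl]) rfl rfl (by simp [htmp]) (by omega) (by omega) (by omega))
  have l3P := length_accP_le (accP (accP [] (encodeNat u)) (encodeNat v)) (encodeNat w)
  have l3N := length_accN_le (accN (accN [] (encodeNat u)) (encodeNat v)) (encodeNat w)
  have c4 := c3.seq (runs_finish _ (pP := accP (accP (accP [] (encodeNat u)) (encodeNat v)) (encodeNat w))
    (pN := accN (accN (accN [] (encodeNat u)) (encodeNat v)) (encodeNat w)) (m := β + 3) (e := e) rfl rfl
    (by simp [hhe]) (by simp [htmp]) (by omega) (by omega))
  refine c4.of_eq ?_ (by unfold T3; omega)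
  simp only [state, bitsToNat_accP, bitsToNat_accN, bitsToNat_nil, Nat.zero_add, tst]
  congr 1
  cases ρ; simp only at hmc htokc; simp [hmc, htokc]

/-! #### The three nested loops -/

/-- The innermost body: read the next word `w` of `un` onto `cl`, test the triple, clear `cl`.
[folklore] -/
def body3 : Com (K ⊕ AReg) := ((popItem.map (πLA K.un K.cl) ;; clear (Sum.inl K.incl)) ;; test3) ;; clear (Sum.inl K.cl)

/-- The innermost loop, over the words of `un`. [folklore] -/
def loop3 : Com (K ⊕ AReg) := loop (Sum.inl K.un) (push (Sum.inl K.un) true ;; body3) (push (Sum.inl K.un) false ;; body3)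

/-- The cost of `loop3` over `m` items of total code length `ℓ`. [folklore] -/
def C3 (m ℓ β : ℕ) : ℕ := m * (13 * ℓ + T3 β + 2 * β + 13) + 1

/-- `QClean ρ`: the registers that every loop body finds and leaves empty. [folklore] -/
structure QClean (ρ : St) : Prop where
  cl : ρ.cl = []
  incl : ρ.incl = []
  it1 : ρ.it1 = []
  it2 : ρ.it2 = []
  mc : ρ.mc = []
  tokc : ρ.tokc = []
  tmp : ρ.tmp = []

/-- The code of a value item is never empty. [folklore] -/
theorem exists_valItem_eq_cons (w : ℕ) : ∃ (c₀ : Bool) (crest : List Bool), encItem (encodeNat w) true = c₀ :: crest := by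
  cases h : encItem (encodeNat w) true with
  | nil => have := congrArg List.length h; simp at this
  | cons c₀ crest => exact ⟨_, _, rfl⟩

/-- **The innermost loop.** With the words `u`, `v` on `adr`, `a0` and the items of `ws` on `un`:
`he := flag (e || ws.any (tst u v))`, `un` emptied, within `C3 |ws| |valItems ws| β`. [folklore] -/
theorem runs_loop3 {u v : ℕ} {β : ℕ} (hu : (encodeNat u).length ≤ β) (hv : (encodeNat v).length ≤ β) :
    ∀ (ws : List ℕ) (ρ : St) (e : Bool), ρ.un = valItems ws → ρ.adr = encodeNat u → ρ.a0 = encodeNat v →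
    ρ.he = flag e → QClean ρ → (∀ w ∈ ws, (encodeNat w).length ≤ β) →
    Runs loop3 (state ρ F0) (state { ρ with un := [], he := flag (e || ws.any (tst u v)) } F0)
      (C3 ws.length (valItems ws).length β)
  | [], ρ, e, hun, _, _, hhe, _, _ => by
    refine (Runs.loop_nil _ _ (by simp [state, hun])).of_eq ?_ (by simp [C3])
    simp only [state, List.any_nil, Bool.or_false]
    congr 1
    cases ρ; simp only at hun hhe; simp [hun, hhe]
  | w :: ws, ρ, e, hun, hadr, ha0, hhe, hq, hws => by
    have hw : (encodeNat w).length ≤ β := hws w (by simp)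
    have hws' : ∀ w' ∈ ws, (encodeNat w').length ≤ β := fun w' h => hws w' (by simp [h])
    obtain ⟨c₀, crest, hcode⟩ := exists_valItem_eq_cons w
    have hun' : ρ.un = c₀ :: (crest ++ valItems ws) := by rw [hun, valItems_cons, ← List.cons_append, ← hcode]
    have hk0 : state ρ F0 (Sum.inl K.un) = c₀ :: (crest ++ valItems ws) := by simp [state, hun']
    have hpush : Runs (push (Sum.inl K.un) c₀) (Function.update (state ρ F0) (Sum.inl K.un) (crest ++ valItems ws))
        (state ρ F0) 1 :=
      Runs.push' (by rw [Function.update_self, Function.update_idem, ← hk0, Function.update_eq_self])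
    -- the body
    have hinj : Function.Injective (πLA K.un K.cl) :=
      πLA_injective (by decide) (by decide) (by decide) (by decide) (by decide) (by decide) (by decide)
    have d1 := Runs.map hinj (runs_popItem (encodeNat w) true (valItems ws)) (state ρ F0)
      (fun i => by cases i <;> simp [πLA, state, hun, hq.cl, hq.incl, hq.it1, hq.it2])
    rw [graft_eq_of_PIReg _ hinj] at d1
    simp only [πLA, PIReg.file_Q, PIReg.file_T, PIReg.file_S, PIReg.file_A, PIReg.file_L, state,
      Sum.update_elim_inl, update_regs_it2, update_regs_it1, update_regs_incl, update_regs_cl, update_regs_un] at d1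
    have d2 := d1.seq (runs_clear_flag (Sum.inl K.incl : K ⊕ AReg) (by simp))
    simp only [Sum.update_elim_inl, update_regs_incl] at d2
    have d3 := d2.seq (runs_test3 _ (u := u) (v := v) (w := w) (e := e) (β := β) (by simp [hadr]) (by simp [ha0]) rfl
      (by simp [hq.mc]) (by simp [hq.tokc]) (by simp [hhe]) (by simp [hq.tmp]) hu hv hw)
    have d4 := d3.seq (runs_clear (Sum.inl K.cl : K ⊕ AReg) _)
    simp only [Sum.elim_inl, regs_cl, Sum.update_elim_inl, update_regs_cl] at d4
    have hbody := hpush.seq d4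
    set ρ₁ : St := { ρ with un := valItems ws, he := flag (e || tst u v w) } with hρ₁
    have hq₁ : QClean ρ₁ := ⟨hq.cl, hq.incl, hq.it1, hq.it2, hq.mc, hq.tokc, hq.tmp⟩
    have ih := runs_loop3 hu hv ws ρ₁ (e || tst u v w) rfl hadr ha0 rfl hq₁ hws'
    have hfin : ({ ρ₁ with un := [], he := flag ((e || tst u v w) || ws.any (tst u v)) } : St) =
        { ρ with un := [], he := flag (e || (w :: ws).any (tst u v)) } := by
      simp only [hρ₁, List.any_cons, Bool.or_assoc]
    have hmid : state ρ₁ F0 = state { ρ with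
        un := valItems ws, cl := [], incl := [], it1 := [], it2 := [], he := flag (e || tst u v w) } F0 := by
      simp only [state, hρ₁]; congr 1; cases ρ; cases hq; simp_all
    rw [hmid] at ih
    have e1 : C3 (w :: ws).length (valItems (w :: ws)).length β =
        (13 * (valItems (w :: ws)).length + T3 β + 2 * β + 13) + C3 ws.length (valItems (w :: ws)).length β := by
      simp only [C3, List.length_cons]; ring
    have hmono : C3 ws.length (valItems ws).length β ≤ C3 ws.length (valItems (w :: ws)).length β := by
      unfold C3; exact Nat.add_le_add_right (Nat.mul_le_mul_left _ (by simp)) _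
    rw [e1]
    have hlen : (encItem (encodeNat w) true ++ valItems ws).length = (valItems (w :: ws)).length := by simp
    cases c₀
    · refine (Runs.loop_false hk0 hbody (ih.of_eq (by rw [hfin]) hmono)).of_eq rfl ?_
      simp only [List.length_append, length_encItem, valItems_cons]
      omega
    · refine (Runs.loop_true hk0 hbody (ih.of_eq (by rw [hfin]) hmono)).of_eq rfl ?_
      simp only [List.length_append, length_encItem, valItems_cons]
      omega

/-- `C3` is monotone in the item count and the code length. [folklore] -/
theorem C3_mono {m m' ℓ ℓ' : ℕ} (hm : m ≤ m') (hℓ : ℓ ≤ ℓ') (β : ℕ) : C3 m ℓ β ≤ C3 m' ℓ' β := by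
  unfold C3
  exact Nat.add_le_add_right (Nat.mul_le_mul hm (by omega)) _

/-- The middle functional model: some pair after `u`. [folklore] -/
def F2 (u : ℕ) : List ℕ → Bool
  | [] => false
  | v :: ws => ws.any (tst u v) || F2 u ws

/-- The outer functional model: some triple. [folklore] -/
def F1 : List ℕ → Bool
  | [] => false
  | u :: ws => F2 u ws || F1 ws

/-- The middle body: read the next word `v` of `nrev2` onto `a0`, copy the rest of the list onto
`un`, run the innermost loop, clear `a0`. [folklore] -/
def body2 : Com (K ⊕ AReg) :=
  (((popItem.map (πLA K.nrev2 K.a0) ;; clear (Sum.inl K.incl)) ;;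
    copy (Sum.inl K.nrev2) (Sum.inl K.un) (Sum.inl K.tmp) (Sum.inr AReg.s)) ;; loop3) ;; clear (Sum.inl K.a0)

/-- The middle loop, over the words of `nrev2`. [folklore] -/
def loop2 : Com (K ⊕ AReg) :=
  loop (Sum.inl K.nrev2) (push (Sum.inl K.nrev2) true ;; body2) (push (Sum.inl K.nrev2) false ;; body2)

/-- The cost of `loop2` over `m` items of total code length `ℓ`. [folklore] -/
def C2 (m ℓ β : ℕ) : ℕ := m * (23 * ℓ + C3 m ℓ β + 2 * β + 16) + 1

/-- `C2` is monotone in the item count and the code length. [folklore] -/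
theorem C2_mono {m m' ℓ ℓ' : ℕ} (hm : m ≤ m') (hℓ : ℓ ≤ ℓ') (β : ℕ) : C2 m ℓ β ≤ C2 m' ℓ' β := by
  unfold C2
  have := C3_mono hm hℓ β
  exact Nat.add_le_add_right (Nat.mul_le_mul hm (by omega)) _

/-- **The middle loop.** With `u` on `adr` and the items of `ws` on `nrev2`: `he := flag (e || F2 u ws)`,
`nrev2` emptied, within `C2 |ws| |valItems ws| β`. [folklore] -/
theorem runs_loop2 {u : ℕ} {β : ℕ} (hu : (encodeNat u).length ≤ β) :
    ∀ (ws : List ℕ) (ρ : St) (e : Bool), ρ.nrev2 = valItems ws → ρ.adr = encodeNat u → ρ.a0 = [] → ρ.un = [] →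
    ρ.he = flag e → QClean ρ → (∀ w ∈ ws, (encodeNat w).length ≤ β) →
    Runs loop2 (state ρ F0) (state { ρ with nrev2 := [], he := flag (e || F2 u ws) } F0)
      (C2 ws.length (valItems ws).length β)
  | [], ρ, e, hl, _, _, _, hhe, _, _ => by
    refine (Runs.loop_nil _ _ (by simp [state, hl])).of_eq ?_ (by simp [C2])
    simp only [state, F2, Bool.or_false]
    congr 1
    cases ρ; simp only at hl hhe; simp [hl, hhe]
  | v :: ws, ρ, e, hl, hadr, ha0, hun, hhe, hq, hws => by
    have hv : (encodeNat v).length ≤ β := hws v (by simp)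
    have hws' : ∀ w' ∈ ws, (encodeNat w').length ≤ β := fun w' h => hws w' (by simp [h])
    obtain ⟨c₀, crest, hcode⟩ := exists_valItem_eq_cons v
    have hl' : ρ.nrev2 = c₀ :: (crest ++ valItems ws) := by rw [hl, valItems_cons, ← List.cons_append, ← hcode]
    have hk0 : state ρ F0 (Sum.inl K.nrev2) = c₀ :: (crest ++ valItems ws) := by simp [state, hl']
    have hpush : Runs (push (Sum.inl K.nrev2) c₀) (Function.update (state ρ F0) (Sum.inl K.nrev2) (crest ++ valItems ws))
        (state ρ F0) 1 :=
      Runs.push' (by rw [Function.update_self, Function.update_idem, ← hk0, Function.update_eq_self])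
    -- the body
    have hinj : Function.Injective (πLA K.nrev2 K.a0) :=
      πLA_injective (by decide) (by decide) (by decide) (by decide) (by decide) (by decide) (by decide)
    have d1 := Runs.map hinj (runs_popItem (encodeNat v) true (valItems ws)) (state ρ F0)
      (fun i => by cases i <;> simp [πLA, state, hl, ha0, hq.incl, hq.it1, hq.it2])
    rw [graft_eq_of_PIReg _ hinj] at d1
    simp only [πLA, PIReg.file_Q, PIReg.file_T, PIReg.file_S, PIReg.file_A, PIReg.file_L, state,
      Sum.update_elim_inl, update_regs_it2, update_regs_it1, update_regs_incl, update_regs_a0, update_regs_nrev2] at d1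
    have d2 := d1.seq (runs_clear_flag (Sum.inl K.incl : K ⊕ AReg) (by simp))
    simp only [Sum.update_elim_inl, update_regs_incl] at d2
    have d3 := d2.seq (runs_copy (a := (Sum.inl K.nrev2 : K ⊕ AReg)) (b := Sum.inl K.un) (t := Sum.inl K.tmp)
      (u := Sum.inr AReg.s) (by simp) (by simp) (by simp) (by simp) (by simp) (by simp) _ (by simp [hq.tmp]) (by simp))
    simp only [Sum.elim_inl, regs_nrev2, regs_un, hun, List.append_nil, Sum.update_elim_inl, update_regs_un] at d3
    have d4 := d3.seq (runs_loop3 hu hv ws _ e rfl (by simp [hadr]) rfl (by simp [hhe])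
      ⟨by simp [hq.cl], rfl, rfl, rfl, by simp [hq.mc], by simp [hq.tokc], by simp [hq.tmp]⟩ hws')
    have d5 := d4.seq (runs_clear (Sum.inl K.a0 : K ⊕ AReg) _)
    simp only [state, Sum.elim_inl, regs_a0, Sum.update_elim_inl, update_regs_a0] at d5
    have hbody := hpush.seq d5
    set ρ₁ : St := { ρ with nrev2 := valItems ws, he := flag (e || ws.any (tst u v)) } with hρ₁
    have hq₁ : QClean ρ₁ := ⟨hq.cl, hq.incl, hq.it1, hq.it2, hq.mc, hq.tokc, hq.tmp⟩
    have ih := runs_loop2 hu ws ρ₁ (e || ws.any (tst u v)) rfl hadr ha0 hun rfl hq₁ hws'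
    have hfin : ({ ρ₁ with nrev2 := [], he := flag ((e || ws.any (tst u v)) || F2 u ws) } : St) =
        { ρ with nrev2 := [], he := flag (e || F2 u (v :: ws)) } := by
      simp only [hρ₁, F2, Bool.or_assoc]
    have hmid : state ρ₁ F0 = state { ρ with
        nrev2 := valItems ws, a0 := [], un := [], incl := [], it1 := [], it2 := [],
        he := flag (e || ws.any (tst u v)) } F0 := by
      simp only [state, hρ₁]; congr 1; cases ρ; cases hq; simp_all
    rw [hmid] at ih
    have e1 : C2 (v :: ws).length (valItems (v :: ws)).length β =
        (23 * (valItems (v :: ws)).length + C3 (v :: ws).length (valItems (v :: ws)).length β + 2 * β + 16) +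
          (ws.length * (23 * (valItems (v :: ws)).length + C3 (v :: ws).length (valItems (v :: ws)).length β +
            2 * β + 16) + 1) := by
      simp only [C2, List.length_cons]; ring
    have hmono : C2 ws.length (valItems ws).length β ≤
        ws.length * (23 * (valItems (v :: ws)).length + C3 (v :: ws).length (valItems (v :: ws)).length β +
          2 * β + 16) + 1 := by
      unfold C2
      have := C3_mono (m := ws.length) (m' := (v :: ws).length) (ℓ := (valItems ws).length)
        (ℓ' := (valItems (v :: ws)).length) (by simp) (by simp) β
      exact Nat.add_le_add_right (Nat.mul_le_mul_left _ (by simp at this ⊢; omega)) _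
    have h3 : C3 ws.length (valItems ws).length β ≤ C3 (v :: ws).length (valItems (v :: ws)).length β :=
      C3_mono (by simp) (by simp) β
    rw [e1]
    cases c₀
    · refine (Runs.loop_false hk0 hbody (ih.of_eq (by rw [hfin]) hmono)).of_eq rfl ?_
      simp only [List.length_append, length_encItem, valItems_cons]
      simp only [valItems_cons, List.length_append, length_encItem] at h3
      omega
    · refine (Runs.loop_true hk0 hbody (ih.of_eq (by rw [hfin]) hmono)).of_eq rfl ?_
      simp only [List.length_append, length_encItem, valItems_cons]
      simp only [valItems_cons, List.length_append, length_encItem] at h3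
      omega

/-- The outer body: read the next word `u` of `nrev` onto `adr`, copy the rest of the list onto
`nrev2`, run the middle loop, clear `adr`. [folklore] -/
def body1 : Com (K ⊕ AReg) :=
  (((popItem.map (πLA K.nrev K.adr) ;; clear (Sum.inl K.incl)) ;;
    copy (Sum.inl K.nrev) (Sum.inl K.nrev2) (Sum.inl K.tmp) (Sum.inr AReg.s)) ;; loop2) ;; clear (Sum.inl K.adr)

/-- The outer loop, over the words of `nrev`: the brute-force 3SUM test of the item list. [folklore] -/
def loop1 : Com (K ⊕ AReg) :=
  loop (Sum.inl K.nrev) (push (Sum.inl K.nrev) true ;; body1) (push (Sum.inl K.nrev) false ;; body1)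

/-- The cost of `loop1` over `m` items of total code length `ℓ`. [folklore] -/
def C1 (m ℓ β : ℕ) : ℕ := m * (23 * ℓ + C2 m ℓ β + 2 * β + 16) + 1

/-- `C1` is monotone in the item count and the code length. [folklore] -/
theorem C1_mono {m m' ℓ ℓ' : ℕ} (hm : m ≤ m') (hℓ : ℓ ≤ ℓ') (β : ℕ) : C1 m ℓ β ≤ C1 m' ℓ' β := by
  unfold C1
  have := C2_mono hm hℓ β
  exact Nat.add_le_add_right (Nat.mul_le_mul hm (by omega)) _

/-- **The outer loop: brute-force 3SUM.** With the items of `ws` on `nrev` (and `nrev2`, `un`, `adr`,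
`a0` empty): `he := flag (e || F1 ws)`, `nrev` emptied, within `C1 |ws| |valItems ws| β`. [folklore] -/
theorem runs_loop1 {β : ℕ} :
    ∀ (ws : List ℕ) (ρ : St) (e : Bool), ρ.nrev = valItems ws → ρ.nrev2 = [] → ρ.adr = [] → ρ.a0 = [] → ρ.un = [] →
    ρ.he = flag e → QClean ρ → (∀ w ∈ ws, (encodeNat w).length ≤ β) →
    Runs loop1 (state ρ F0) (state { ρ with nrev := [], he := flag (e || F1 ws) } F0)
      (C1 ws.length (valItems ws).length β)
  | [], ρ, e, hl, _, _, _, _, hhe, _, _ => by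
    refine (Runs.loop_nil _ _ (by simp [state, hl])).of_eq ?_ (by simp [C1])
    simp only [state, F1, Bool.or_false]
    congr 1
    cases ρ; simp only at hl hhe; simp [hl, hhe]
  | u :: ws, ρ, e, hl, hl2, hadr, ha0, hun, hhe, hq, hws => by
    have hu : (encodeNat u).length ≤ β := hws u (by simp)
    have hws' : ∀ w' ∈ ws, (encodeNat w').length ≤ β := fun w' h => hws w' (by simp [h])
    obtain ⟨c₀, crest, hcode⟩ := exists_valItem_eq_cons u
    have hl' : ρ.nrev = c₀ :: (crest ++ valItems ws) := by rw [hl, valItems_cons, ← List.cons_append, ← hcode]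
    have hk0 : state ρ F0 (Sum.inl K.nrev) = c₀ :: (crest ++ valItems ws) := by simp [state, hl']
    have hpush : Runs (push (Sum.inl K.nrev) c₀) (Function.update (state ρ F0) (Sum.inl K.nrev) (crest ++ valItems ws))
        (state ρ F0) 1 :=
      Runs.push' (by rw [Function.update_self, Function.update_idem, ← hk0, Function.update_eq_self])
    -- the body
    have hinj : Function.Injective (πLA K.nrev K.adr) :=
      πLA_injective (by decide) (by decide) (by decide) (by decide) (by decide) (by decide) (by decide)
    have d1 := Runs.map hinj (runs_popItem (encodeNat u) true (valItems ws)) (state ρ F0)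
      (fun i => by cases i <;> simp [πLA, state, hl, hadr, hq.incl, hq.it1, hq.it2])
    rw [graft_eq_of_PIReg _ hinj] at d1
    simp only [πLA, PIReg.file_Q, PIReg.file_T, PIReg.file_S, PIReg.file_A, PIReg.file_L, state,
      Sum.update_elim_inl, update_regs_it2, update_regs_it1, update_regs_incl, update_regs_adr, update_regs_nrev] at d1
    have d2 := d1.seq (runs_clear_flag (Sum.inl K.incl : K ⊕ AReg) (by simp))
    simp only [Sum.update_elim_inl, update_regs_incl] at d2
    have d3 := d2.seq (runs_copy (a := (Sum.inl K.nrev : K ⊕ AReg)) (b := Sum.inl K.nrev2) (t := Sum.inl K.tmp)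
      (u := Sum.inr AReg.s) (by simp) (by simp) (by simp) (by simp) (by simp) (by simp) _ (by simp [hq.tmp]) (by simp))
    simp only [Sum.elim_inl, regs_nrev, regs_nrev2, hl2, List.append_nil, Sum.update_elim_inl, update_regs_nrev2] at d3
    have d4 := d3.seq (runs_loop2 hu ws _ e rfl rfl (by simp [ha0]) (by simp [hun]) (by simp [hhe])
      ⟨by simp [hq.cl], rfl, rfl, rfl, by simp [hq.mc], by simp [hq.tokc], by simp [hq.tmp]⟩ hws')
    have d5 := d4.seq (runs_clear (Sum.inl K.adr : K ⊕ AReg) _)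
    simp only [state, Sum.elim_inl, regs_adr, Sum.update_elim_inl, update_regs_adr] at d5
    have hbody := hpush.seq d5
    set ρ₁ : St := { ρ with nrev := valItems ws, he := flag (e || F2 u ws) } with hρ₁
    have hq₁ : QClean ρ₁ := ⟨hq.cl, hq.incl, hq.it1, hq.it2, hq.mc, hq.tokc, hq.tmp⟩
    have ih := runs_loop1 ws ρ₁ (e || F2 u ws) rfl hl2 hadr ha0 hun rfl hq₁ hws'
    have hfin : ({ ρ₁ with nrev := [], he := flag ((e || F2 u ws) || F1 ws) } : St) =
        { ρ with nrev := [], he := flag (e || F1 (u :: ws)) } := by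
      simp only [hρ₁, F1, Bool.or_assoc]
    have hmid : state ρ₁ F0 = state { ρ with
        nrev := valItems ws, adr := [], nrev2 := [], incl := [], it1 := [], it2 := [],
        he := flag (e || F2 u ws) } F0 := by
      simp only [state, hρ₁]; congr 1; cases ρ; cases hq; simp_all
    rw [hmid] at ih
    have e1 : C1 (u :: ws).length (valItems (u :: ws)).length β =
        (23 * (valItems (u :: ws)).length + C2 (u :: ws).length (valItems (u :: ws)).length β + 2 * β + 16) +
          (ws.length * (23 * (valItems (u :: ws)).length + C2 (u :: ws).length (valItems (u :: ws)).length β +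
            2 * β + 16) + 1) := by
      simp only [C1, List.length_cons]; ring
    have hmono : C1 ws.length (valItems ws).length β ≤
        ws.length * (23 * (valItems (u :: ws)).length + C2 (u :: ws).length (valItems (u :: ws)).length β +
          2 * β + 16) + 1 := by
      unfold C1
      have := C2_mono (m := ws.length) (m' := (u :: ws).length) (ℓ := (valItems ws).length)
        (ℓ' := (valItems (u :: ws)).length) (by simp) (by simp) β
      exact Nat.add_le_add_right (Nat.mul_le_mul_left _ (by simp at this ⊢; omega)) _
    have h2 : C2 ws.length (valItems ws).length β ≤ C2 (u :: ws).length (valItems (u :: ws)).length β :=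
      C2_mono (by simp) (by simp) β
    rw [e1]
    cases c₀
    · refine (Runs.loop_false hk0 hbody (ih.of_eq (by rw [hfin]) hmono)).of_eq rfl ?_
      simp only [List.length_append, length_encItem, valItems_cons]
      simp only [valItems_cons, List.length_append, length_encItem] at h2
      omega
    · refine (Runs.loop_true hk0 hbody (ih.of_eq (by rw [hfin]) hmono)).of_eq rfl ?_
      simp only [List.length_append, length_encItem, valItems_cons]
      simp only [valItems_cons, List.length_append, length_encItem] at h2
      omega

/-! #### The functional model decides 3SUM -/

/-- `List.any` as a one-element sublist. [folklore] -/
theorem any_tst_eq_true_iff (u v : ℕ) (ws : List ℕ) :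
    ws.any (tst u v) = true ↔ ∃ w, [w].Sublist ws ∧ tst u v w = true := by
  simp [List.any_eq_true, List.singleton_sublist]

/-- `F2 u ws` holds iff some pair `[v, w]` is a sublist of `ws` with `tst u v w`. [folklore] -/
theorem F2_eq_true_iff (u : ℕ) : ∀ ws : List ℕ, F2 u ws = true ↔ ∃ v w, [v, w].Sublist ws ∧ tst u v w = true
  | [] => by simp [F2]
  | v' :: ws => by
    rw [F2, Bool.or_eq_true, F2_eq_true_iff u ws, any_tst_eq_true_iff]
    constructor
    · rintro (⟨w, hw, ht⟩ | ⟨v, w, hvw, ht⟩)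
      · exact ⟨v', w, hw.cons_cons v', ht⟩
      · exact ⟨v, w, hvw.cons v', ht⟩
    · rintro ⟨v, w, hvw, ht⟩
      rcases List.sublist_cons_iff.1 hvw with h | ⟨r, hr, hr'⟩
      · exact Or.inr ⟨v, w, h, ht⟩
      · obtain ⟨rfl, rfl⟩ := List.cons.inj hr
        exact Or.inl ⟨w, hr', ht⟩

/-- `F1 ws` holds iff some triple `[u, v, w]` is a sublist of `ws` with `tst u v w`. [folklore] -/
theorem F1_eq_true_iff : ∀ ws : List ℕ, F1 ws = true ↔ ∃ u v w, [u, v, w].Sublist ws ∧ tst u v w = true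
  | [] => by simp [F1]
  | u' :: ws => by
    rw [F1, Bool.or_eq_true, F1_eq_true_iff ws, F2_eq_true_iff]
    constructor
    · rintro (⟨v, w, hvw, ht⟩ | ⟨u, v, w, h, ht⟩)
      · exact ⟨u', v, w, hvw.cons_cons u', ht⟩
      · exact ⟨u, v, w, h.cons u', ht⟩
    · rintro ⟨u, v, w, h, ht⟩
      rcases List.sublist_cons_iff.1 h with h | ⟨r, hr, hr'⟩
      · exact Or.inr ⟨u, v, w, h, ht⟩
      · obtain ⟨rfl, rfl⟩ := List.cons.inj hr
        exact Or.inl ⟨v, w, hr', ht⟩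

/-- The zig-zag decoding in terms of positive and negative parts. [folklore] -/
theorem intEquivNat_symm_eq (w : ℕ) : Equiv.intEquivNat.symm w = (posPart w : ℤ) - (negPart w : ℤ) := by
  rw [Equiv.symm_apply_eq]
  unfold posPart negPart
  rcases Nat.even_or_odd w with ⟨v, hv⟩ | ⟨v, hv⟩
  · have e1 : (if w % 2 = 0 then w / 2 else 0) = v := by rw [if_pos (by omega)]; omega
    have e2 : (if w % 2 = 1 then w / 2 + 1 else 0) = 0 := by rw [if_neg (by omega)]
    rw [e1, e2, Nat.cast_zero, sub_zero, show Equiv.intEquivNat (v : ℤ) = 2 * v from rfl]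
    omega
  · have e1 : (if w % 2 = 0 then w / 2 else 0) = 0 := by rw [if_neg (by omega)]
    have e2 : (if w % 2 = 1 then w / 2 + 1 else 0) = v + 1 := by rw [if_pos (by omega)]; omega
    rw [e1, e2, Nat.cast_zero, zero_sub, show -((v + 1 : ℕ) : ℤ) = Int.negSucc v from rfl,
      show Equiv.intEquivNat (Int.negSucc v) = 2 * v + 1 from rfl]
    omega

/-- **The test is the zero-sum test of the decoded words.** [folklore] -/
theorem tst_eq_true_iff (u v w : ℕ) :
    tst u v w = true ↔ Equiv.intEquivNat.symm u + Equiv.intEquivNat.symm v + Equiv.intEquivNat.symm w = 0 := by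
  rw [tst, decide_eq_true_iff, intEquivNat_symm_eq, intEquivNat_symm_eq, intEquivNat_symm_eq]
  omega

/-! ### The interpreter with 3SUM queries

The oracle of the simulated run answers every query `q` with the single word `[1]`/`[0]`
according to `HasThreeSum` of the zig-zag decoded words (`ThreeSumAnswers`). The instruction
codes are those of `WordRAMToTM2Interp.lean` with two changes: stores go through `memStore`
(duplicate-free log), and `query qa ql aa` is simulated — the segment is collected by `qRead`,
tested by `loop1`, and the answer (length `1` at `aa`, the answer bit reduced modulo `2^W` right
after) is written by `answer`. -/

/-- `ThreeSumAnswers O`: the oracle answers 3SUM on the zig-zag decoding of every query, by one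
word. [folklore] -/
def ThreeSumAnswers (O : List ℕ → List ℕ) : Prop :=
  ∀ q, O q = [if HasThreeSum (q.map Equiv.intEquivNat.symm) then 1 else 0]

/-- **Values stay bounded** along a step with an oracle whose answers have length at most `1`
(`V ≥ max (2^W - 1) maxConst 1`). [folklore] -/
theorem step_memLE_of_length_le_one {M : Program} {W : ℕ} {O : List ℕ → List ℕ} (hO : ∀ q, (O q).length ≤ 1)
    {ρc : ℕ → ℕ} {c c' : Cfg} {V : ℕ} (hw : 2 ^ W - 1 ≤ V) (h1 : 1 ≤ V) (hP : Program.maxConst M ≤ V)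
    (hc : MemLE V c.mem) (hs : step M W O ρc c = some c') : MemLE V c'.mem := by
  unfold step at hs
  cases hpc : c.pc with
  | none => simp [hpc] at hs
  | some i =>
    simp only [hpc] at hs
    cases hI : M[i]? with
    | none => simp only [hI, Option.some.injEq] at hs; subst hs; exact hc
    | some I =>
      have hIc : I.maxConst ≤ V := le_trans (Instr.maxConst_le_of_getElem? hI) hP
      simp only [hI] at hs
      cases I with
      | halt => simp only [Option.some.injEq] at hs; subst hs; exact hc
      | jmp t => simp only [Option.some.injEq] at hs; subst hs; exact hc
      | jz x t => simp only [Option.some.injEq] at hs; subst hs; exact hc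
      | op o dst x y =>
        simp only [Option.some.injEq] at hs; subst hs
        simp only [Instr.maxConst, max_le_iff] at hIc
        exact Operand.write_memLE hc (BinOp.eval_le (Operand.read_le hc x hIc.2.1) hw h1 o) dst
      | rand dst =>
        simp only [Option.some.injEq] at hs; subst hs
        exact Operand.write_memLE hc (le_trans (mod_two_pow_le _ _) hw) dst
      | query qa ql aa =>
        simp only [Option.some.injEq] at hs
        subst hs
        refine writeSeg_memLE _ _ _ (fun b => ?_) fun v hv => ?_
        · rcases eq_or_ne b (aa.read c.mem) with rfl | h
          · rw [Function.update_self, List.length_map]; exact (hO _).trans h1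
          · rw [Function.update_of_ne h]; exact hc b
        · obtain ⟨u, -, rfl⟩ := List.mem_map.1 hv
          exact le_trans (mod_two_pow_le _ _) hw

/-- A 3SUM oracle answers by one word. [folklore] -/
theorem ThreeSumAnswers.length_le {O : List ℕ → List ℕ} (hO : ThreeSumAnswers O) (q : List ℕ) : (O q).length ≤ 1 := by
  rw [hO q]; simp

/-- `storeCode o`: write the numeral held in `x` through the operand `o` with `memStore` (nothing for
an immediate; the key pushed for a direct operand; read through the log for an indirect one). [folklore] -/
def storeCode : Operand → Com (K ⊕ AReg)
  | .imm _ => clear (Sum.inr AReg.x)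
  | .dir a => pushNum (Sum.inl K.key) (encodeNat a) ;; memStore
  | .ind a => (((pushNum (Sum.inl K.key) (encodeNat a) ;; memRead) ;; clear (Sum.inl K.key)) ;;
      move (Sum.inl K.val) (Sum.inl K.key) (Sum.inl K.tmp)) ;; memStore

/-- The log after a store through an operand. [folklore] -/
def storeLogOp (E : List (List Bool × List Bool)) (mem : ℕ → ℕ) (v : ℕ) : Operand → List (List Bool × List Bool)
  | .imm _ => E
  | .dir a => storeLog E (encodeNat a) (encodeNat v)
  | .ind a => storeLog E (encodeNat (mem a)) (encodeNat v)

/-- `qRead qa ql`: load the query address and length, turn the length into a unary counter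
(Horner), read the segment onto `nrev`. [folklore] -/
def qRead (qa ql : Operand) : Com (K ⊕ AReg) :=
  ((((loadTo (Sum.inr AReg.x) qa ;; loadTo (Sum.inr AReg.y) ql) ;; pour (Sum.inr AReg.y) (Sum.inl K.scr)) ;;
    hornerLoop wregs) ;; readLoop) ;; clear (Sum.inr AReg.x)

/-- `answer aa`: write the answer of the oracle — the length `1` at the answer address, then the bit
held on `he`, reduced modulo `2^W`, at the next address. [folklore] -/
def answer (aa : Operand) : Com (K ⊕ AReg) :=
  ((((((((loadTo (Sum.inr AReg.x) aa ;; copy (Sum.inr AReg.x) (Sum.inl K.key) (Sum.inl K.tmp) (Sum.inr AReg.s)) ;;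
    incr (Sum.inr AReg.x) (Sum.inr AReg.s) (Sum.inr AReg.t) (Sum.inr AReg.f)) ;;
    move (Sum.inr AReg.x) (Sum.inl K.adr) (Sum.inl K.tmp)) ;; push (Sum.inr AReg.x) true) ;; memStore) ;;
    move (Sum.inl K.adr) (Sum.inl K.key) (Sum.inl K.tmp)) ;;
    pop (Sum.inl K.he) (push (Sum.inr AReg.x) true) skip skip) ;; addW wregs) ;; memStore

/-- The code of the instruction at position `i`, with `memStore` and simulated 3SUM queries. [folklore] -/
def instrCodeQ (i : ℕ) : Instr → Com (K ⊕ AReg)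
  | .op o dst x y => (((loadTo (Sum.inr AReg.x) x ;; loadTo (Sum.inr AReg.y) y) ;; opW o) ;; storeCode dst) ;; next (i + 1)
  | .jmp t => next t
  | .jz x t => loadTo (Sum.inr AReg.x) x ;;
      pop (Sum.inr AReg.x) (clear (Sum.inr AReg.x) ;; next (i + 1)) (clear (Sum.inr AReg.x) ;; next (i + 1)) (next t)
  | .rand dst => storeCode dst ;; next (i + 1)
  | .query qa ql aa => ((qRead qa ql ;; loop1) ;; answer aa) ;; next (i + 1)
  | .halt => skip

/-- Dispatch on the unary program counter (as `dispatchL`, with `instrCodeQ`). [folklore] -/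
def dispatchQ : List Instr → ℕ → Com (K ⊕ AReg)
  | [], _ => clear (Sum.inl K.pc)
  | I :: rest, i => pop (Sum.inl K.pc) (dispatchQ rest (i + 1)) (dispatchQ rest (i + 1)) (instrCodeQ i I)

/-- The body of the interpreter loop. [folklore] -/
def bodyQ (M : Program) : Com (K ⊕ AReg) := dispatchQ M 0

/-- The interpreter with 3SUM queries: repeat the body while the run flag is re-armed. [folklore] -/
def interpQ (M : Program) : Com (K ⊕ AReg) := loop (Sum.inl K.run) (bodyQ M) (bodyQ M)

/-! #### The log invariant -/

/-- `LogInv β A E mem`: the log `E` represents `mem`, is `β`-bounded, has pairwise distinct keys, all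
of them numerals of addresses `≤ A`. [folklore] -/
structure LogInv (β A : ℕ) (E : List (List Bool × List Bool)) (mem : ℕ → ℕ) : Prop where
  rep : Represents E mem
  bdd : BoundedLog β E
  nodup : (E.map Prod.fst).Nodup
  keys : KeysBelow A E

/-- The invariant after a store at an address `≤ A` of a value with a `β`-bit numeral. [folklore] -/
theorem LogInv.store {β A : ℕ} {E : List (List Bool × List Bool)} {mem : ℕ → ℕ} (h : LogInv β A E mem) {a v : ℕ}
    (ha : a ≤ A) (hka : (encodeNat a).length ≤ β) (hv : (encodeNat v).length ≤ β) :
    LogInv β A (storeLog E (encodeNat a) (encodeNat v)) (Function.update mem a v) :=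
  ⟨h.rep.store a v, h.bdd.storeLog hka hv, nodup_keys_storeLog h.nodup _ _, h.keys.storeLog ha _⟩

/-- A log satisfying the invariant has at most `A + 1` entries. [folklore] -/
theorem LogInv.length_le {β A : ℕ} {E : List (List Bool × List Bool)} {mem : ℕ → ℕ} (h : LogInv β A E mem) :
    E.length ≤ A + 1 :=
  length_le_of_nodup_keysBelow h.nodup h.keys

/-- The code of a log satisfying the invariant has length at most `(4β + 4)(A + 1)`. [folklore] -/
theorem LogInv.length_encLog_le {β A : ℕ} {E : List (List Bool × List Bool)} {mem : ℕ → ℕ} (h : LogInv β A E mem) :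
    (encLog E).length ≤ (4 * β + 4) * (A + 1) :=
  (ToTM2.length_encLog_le h.bdd).trans (Nat.mul_le_mul_left _ h.length_le)

/-! #### Storing through an operand -/

/-- The uniform cost of `storeCode` for logs of at most `n` entries and code length at most `L`.
[folklore] -/
def storeCostQ (L n β : ℕ) : ℕ := storeCostD n L β + L * (3 * β + 17) + 12 * β + 15

/-- **The new log represents `Operand.write`.** [folklore] -/
theorem logInv_storeLogOp {β A V : ℕ} {E : List (List Bool × List Bool)} {mem : ℕ → ℕ} (h : LogInv β A E mem)
    (hV : MemLE V mem) (hVA : V ≤ A) (hβ : (encodeNat A).length ≤ β) {v : ℕ} (hv : (encodeNat v).length ≤ β) (o : Operand)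
    (ho : o.const ≤ V) : LogInv β A (storeLogOp E mem v o) (o.write mem v) := by
  cases o with
  | imm c => exact h
  | dir a =>
    simp only [Operand.const] at ho
    exact h.store (ho.trans hVA) ((Brick.length_encodeNat_mono (ho.trans hVA)).trans hβ) hv
  | ind a => exact h.store ((hV a).trans hVA) ((Brick.length_encodeNat_mono ((hV a).trans hVA)).trans hβ) hv

/-- A configuration file is `DClean`. [folklore] -/
theorem dclean_cfgSt (W : ℕ) (E : List (List Bool × List Bool)) (pc : Option ℕ) (run : List Bool) :
    DClean (cfgSt W E pc run) := ⟨rfl, rfl, rfl, rfl, rfl, rfl, rfl, rfl, rfl⟩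

/-- **Storing** the numeral of `v` held in `x` through `o`: the log becomes `storeLogOp`, `x` is
emptied, within `storeCostQ L n β` whenever `|encLog E| ≤ L` and `|E| ≤ n`. [folklore] -/
theorem runs_storeCode {W : ℕ} {E : List (List Bool × List Bool)} {mem : ℕ → ℕ} {β A : ℕ} (h : LogInv β A E mem)
    (hmemβ : ∀ b, (encodeNat (mem b)).length ≤ β) (o : Operand) (ho : (encodeNat o.const).length ≤ β)
    (v : ℕ) (hv : (encodeNat v).length ≤ β) (y : List Bool) {L n : ℕ} (hL : (encLog E).length ≤ L) (hn : E.length ≤ n) :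
    Runs (storeCode o) (state (cfgSt W E none []) (AReg.file (encodeNat v) y [] [] [] [] [] []))
      (state (cfgSt W (storeLogOp E mem v o) none []) (AReg.file [] y [] [] [] [] [] [])) (storeCostQ L n β) := by
  have hclean := iclean_cfgSt W E none []
  have hsc : storeCostD E.length (encLog E).length β ≤ storeCostD n L β := storeCostD_mono hn hL β
  unfold storeCostQ
  cases o with
  | imm c =>
    have h1 := runs_clear (Sum.inr AReg.x : K ⊕ AReg) (state (cfgSt W E none []) (AReg.file (encodeNat v) y [] [] [] [] [] []))
    simp only [state, Sum.elim_inr, AReg.file_x, Sum.update_elim_inr, AReg.update_file_x] at h1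
    exact h1.of_eq rfl (by unfold storeCostD; nlinarith [hv])
  | dir a =>
    simp only [Operand.const] at ho
    have h1 := runs_pushNum (Sum.inl K.key : K ⊕ AReg) (encodeNat a) (state (cfgSt W E none []) (AReg.file (encodeNat v) y [] [] [] [] [] []))
    simp only [state, Sum.elim_inl, regs_key, cfgSt_key, List.append_nil, Sum.update_elim_inl, update_regs_key] at h1
    have h2 := h1.seq (runs_memStore _ (encodeNat v) y [] [] [] [] [] E (encodeNat a) β ho hv h.bdd rfl rfl rfl rfl
      ⟨rfl, rfl, rfl, rfl, rfl, rfl, rfl, rfl, rfl⟩)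
    refine h2.of_eq ?_ (by omega)
    simp [state, storeLogOp, cfgSt]
  | ind a =>
    simp only [Operand.const] at ho
    have h1 := runs_pushNum (Sum.inl K.key : K ⊕ AReg) (encodeNat a) (state (cfgSt W E none []) (AReg.file (encodeNat v) y [] [] [] [] [] []))
    simp only [state, Sum.elim_inl, regs_key, cfgSt_key, List.append_nil, Sum.update_elim_inl, update_regs_key] at h1
    have h2 := h1.seq (runs_memRead _ _ E (encodeNat a) rfl rfl rfl rfl rfl rfl rfl rfl rfl rfl)
    have h3 := (h2.seq (runs_clear (Sum.inl K.key : K ⊕ AReg) _)).seq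
      (runs_move (a := (Sum.inl K.val : K ⊕ AReg)) (b := Sum.inl K.key) (t := Sum.inl K.tmp)
        (by simp) (by simp) (by simp) _ (by simp [state, cfgSt, St.zero]))
    simp only [state, Sum.elim_inl, regs_key, Sum.update_elim_inl, update_regs_key, regs_val,
      List.append_nil, update_regs_val, h.rep.lookup a] at h3
    have h4 := h3.seq (runs_memStore _ (encodeNat v) y [] [] [] [] [] E (encodeNat (mem a)) β (hmemβ a) hv h.bdd rfl
      rfl rfl rfl ⟨rfl, rfl, rfl, rfl, rfl, rfl, rfl, rfl, rfl⟩)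
    refine h4.of_eq ?_ ?_
    · simp [state, storeLogOp, cfgSt]
    · have l1 := hmemβ a
      have : (encLog E).length * (3 * (encodeNat a).length + 17) ≤ L * (3 * β + 17) :=
        Nat.mul_le_mul hL (by omega)
      omega

/-! #### Reading the query -/

/-- The cost of `qRead` (log code length `≤ L`). [folklore] -/
def qReadCost (β V L : ℕ) : ℕ := 2 * loadCost L β + β * (20 * V + 5) + V * (L * (3 * β + 17) + 25 * β + 32) + 5 * β + 4

/-- **Reading the query.** From a configuration file, `qRead qa ql` leaves on `nrev` the items of the
segment `readSeg mem (qa.read mem) (ql.read mem)`, last cell on top, everything else restored.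
[folklore] -/
theorem runs_qRead {W : ℕ} {E : List (List Bool × List Bool)} {mem : ℕ → ℕ} {β A V : ℕ} (h : LogInv β A E mem)
    (hV : MemLE V mem) (hβ : (encodeNat (2 * V)).length ≤ β) (qa ql : Operand) (hqa : qa.const ≤ V) (hql : ql.const ≤ V)
    {L : ℕ} (hL : (encLog E).length ≤ L) :
    Runs (qRead qa ql) (state (cfgSt W E none []) F0)
      (state { cfgSt W E none [] with nrev := valItems (readSeg mem (qa.read mem) (ql.read mem)).reverse } F0)
      (qReadCost β V L) := by
  have hclean := iclean_cfgSt W E none []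
  have lenV : ∀ {v}, v ≤ 2 * V → (encodeNat v).length ≤ β := fun hv => (Brick.length_encodeNat_mono hv).trans hβ
  set qaddr := qa.read mem with hqaddr
  set qlen := ql.read mem with hqlen
  have hqaV : qaddr ≤ V := Operand.read_le hV qa hqa
  have hqlV : qlen ≤ V := Operand.read_le hV ql hql
  have c1 := runs_loadTo hclean h.rep h.bdd qa (lenV (by omega)) AReg.x F0 rfl
  have c2 := c1.seq (runs_loadTo hclean h.rep h.bdd ql (lenV (by omega)) AReg.y _ (by simp))
  simp only [AReg.update_file_x, AReg.update_file_y] at c2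
  rw [← hqaddr, ← hqlen] at c2
  have c3 := c2.seq (runs_pour (a := (Sum.inr AReg.y : K ⊕ AReg)) (b := Sum.inl K.scr) (by simp) _)
  simp only [state, Sum.elim_inr, AReg.file_y, Sum.elim_inl, regs_scr, cfgSt_scr, List.append_nil, Sum.update_elim_inr,
    AReg.update_file_y, Sum.update_elim_inl, update_regs_scr] at c3
  have hmsb : UnLeBin.msbVal 0 (encodeNat qlen).reverse = qlen := by
    rw [UnLeBin.msbVal_reverse, bitsToNat_encodeNat]; simp
  have c4 := c3.seq (runs_hornerLoop wregs (κ := K) (encodeNat qlen).reverse _ 0 V (encodeNat qaddr) [] [] [] [] [] []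
    rfl rfl (by rw [hmsb]; exact hqlV))
  rw [hmsb] at c4
  simp only [wregs, update_regs_scr, update_regs_cn, List.length_reverse] at c4
  have c5 := c4.seq (runs_readLoop h.rep h.bdd le_rfl [] [] [] [] qlen qaddr _
    ⟨rfl, rfl, rfl, rfl, rfl, rfl, rfl, rfl, rfl, rfl, rfl⟩ rfl (lenV (by omega)))
  have c6 := c5.seq (runs_clear (Sum.inr AReg.x : K ⊕ AReg) _)
  simp only [state, Sum.elim_inr, AReg.file_x, Sum.update_elim_inr, AReg.update_file_x] at c6
  refine c6.of_eq ?_ ?_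
  · simp [state, cfgSt, St.zero]
  · have l1 : (encodeNat qlen).length ≤ β := lenV (by omega)
    have l2 : (encodeNat (qaddr + qlen)).length ≤ β := lenV (by omega)
    have m1 : (encodeNat qlen).length * (20 * V + 5) ≤ β * (20 * V + 5) := Nat.mul_le_mul_right _ l1
    have m2 : qlen * ((encLog E).length * (3 * β + 17) + 25 * β + 32) ≤ V * (L * (3 * β + 17) + 25 * β + 32) :=
      Nat.mul_le_mul hqlV (by have := Nat.mul_le_mul_right (3 * β + 17) hL; omega)
    have m3 := loadCost_mono hL β
    unfold qReadCost
    omega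

/-! #### Writing the answer -/

/-- The cost of `answer` (log code length `≤ L`, at most `n` entries). [folklore] -/
def answerCost (W β L n : ℕ) : ℕ := loadCost L β + 2 * storeCostD n L β + 44 * W + 31 * β + 122

/-- **Writing the answer.** From a configuration file with the answer bit `b` on `he`, `answer aa`
stores `1` at `aa.read mem` and `b mod 2^W` right after, keeping the log invariant, and returns to a
configuration file. [folklore] -/
theorem runs_answer {W : ℕ} {E : List (List Bool × List Bool)} {mem : ℕ → ℕ} {β A V : ℕ} (h : LogInv β A E mem)
    (hV : MemLE V mem) (hwV : 2 ^ W - 1 ≤ V) (hVA : V + 1 ≤ A) (hβ : (encodeNat A).length ≤ β) (aa : Operand)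
    (haa : aa.const ≤ V) (b : Bool) :
    Runs (answer aa) (state { cfgSt W E none [] with he := flag b } F0)
      (state (cfgSt W (storeLog (storeLog E (encodeNat (aa.read mem)) (encodeNat 1)) (encodeNat (aa.read mem + 1))
        (encodeNat (b.toNat % 2 ^ W))) none []) F0)
      (answerCost W β ((4 * β + 4) * (A + 1)) (A + 1)) := by
  set aaddr := aa.read mem with haaddr
  have haV : aaddr ≤ V := Operand.read_le hV aa haa
  have lenA : ∀ {v}, v ≤ A → (encodeNat v).length ≤ β := fun hv => (Brick.length_encodeNat_mono hv).trans hβ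
  have e1 : encodeNat 1 = [true] := by decide
  have h1β : 1 ≤ β := by have := lenA (show 1 ≤ A by omega); rwa [e1] at this
  set ρ0 : St := { cfgSt W E none [] with he := flag b } with hρ0
  have hclean : IClean ρ0 W E := ⟨rfl, rfl, rfl, rfl, rfl, rfl, rfl, rfl, rfl, rfl, rfl, rfl, rfl, rfl, rfl, rfl, rfl⟩
  have c1 := runs_loadTo hclean h.rep h.bdd aa (lenA (by omega)) AReg.x F0 rfl
  simp only [AReg.update_file_x] at c1
  rw [← haaddr] at c1
  have c2 := c1.seq (runs_copy (a := (Sum.inr AReg.x : K ⊕ AReg)) (b := Sum.inl K.key) (t := Sum.inl K.tmp) (u := Sum.inr AReg.s)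
    (by simp) (by simp) (by simp) (by simp) (by simp) (by simp) _ (by simp [state, hρ0]) (by simp [state]))
  simp only [state, Sum.elim_inr, AReg.file_x, Sum.elim_inl, regs_key, hρ0, cfgSt_key, List.append_nil,
    Sum.update_elim_inl, update_regs_key] at c2
  have c3 := c2.seq (runs_incr (B := (Sum.inr AReg.x : K ⊕ AReg)) (t := Sum.inr AReg.s) (t2 := Sum.inr AReg.t)
    (fl := Sum.inr AReg.f) (by simp) (by simp) (by simp) (by simp) (by simp) (by simp) _ (by simp) (by simp) (by simp))
  simp only [Sum.elim_inr, AReg.file_x, Sum.update_elim_inr, AReg.update_file_x, ← TokConv.encodeNat_succ_eq_incRes] at c3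
  have c4 := c3.seq (runs_move (a := (Sum.inr AReg.x : K ⊕ AReg)) (b := Sum.inl K.adr) (t := Sum.inl K.tmp) (by simp)
    (by simp) (by simp) _ (by simp [cfgSt, St.zero]))
  simp only [Sum.elim_inr, AReg.file_x, Sum.elim_inl, regs_adr, Sum.update_elim_inr, AReg.update_file_x,
    Sum.update_elim_inl, update_regs_adr] at c4
  have c5 := c4.seq (Runs.push (Sum.inr AReg.x) true _)
  simp only [Sum.elim_inr, AReg.file_x, Sum.update_elim_inr, AReg.update_file_x] at c5
  have hadr0 : (cfgSt W E none []).adr = [] := rfl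
  rw [hadr0, List.append_nil] at c5
  -- first store: `1` at `aaddr`
  have c6 := c5.seq (runs_memStore _ [true] [] [] [] [] [] [] E (encodeNat aaddr) β (lenA (by omega)) (by simpa using h1β)
    h.bdd rfl rfl rfl rfl ⟨rfl, rfl, rfl, rfl, rfl, rfl, rfl, rfl, rfl⟩)
  set E₁ := storeLog E (encodeNat aaddr) (encodeNat 1) with hE₁
  have hinv₁ : LogInv β A E₁ (Function.update mem aaddr 1) := h.store (by omega) (lenA (by omega)) (by rw [e1]; exact h1β)
  rw [← e1, ← hE₁] at c6
  have c7 := c6.seq (runs_move (a := (Sum.inl K.adr : K ⊕ AReg)) (b := Sum.inl K.key) (t := Sum.inl K.tmp) (by simp)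
    (by simp) (by simp) _ (by simp [cfgSt, St.zero]))
  simp only [state, Sum.elim_inl, regs_adr, regs_key, List.append_nil, Sum.update_elim_inl, update_regs_adr,
    update_regs_key] at c7
  -- the answer bit onto `x`
  have c8 : Runs (pop (Sum.inl K.he) (push (Sum.inr AReg.x) true) skip skip)
      (state { cfgSt W E none [] with he := flag b, mem := encLog E₁, key := encodeNat (aaddr + 1) } F0)
      (state { cfgSt W E none [] with mem := encLog E₁, key := encodeNat (aaddr + 1) } (AReg.file (flag b) [] [] [] [] [] [] []))
      3 := by
    cases b
    · refine (Runs.pop_nil _ _ (by simp [state, cfgSt, St.zero]) (Runs.skip _)).of_eq ?_ (by norm_num)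
      simp [state, cfgSt, St.zero, F0]
    · refine (Runs.pop_true' _ _ (w := []) (by simp [state]) rfl (Runs.push' ?_)).of_eq rfl (by norm_num)
      simp [state, cfgSt, St.zero, F0]
  have c9 := (c7.of_eq (by simp [state, cfgSt, St.zero]) le_rfl).seq c8
  have hT : wregs.Clean ({ cfgSt W E none [] with mem := encLog E₁, key := encodeNat (aaddr + 1) } : St).regs W :=
    ⟨rfl, rfl, rfl, rfl, rfl, rfl⟩
  have c10 := c9.seq (runs_addW wregs hT (flag b) [])
  simp only [bitsToNat_flag, bitsToNat_nil, Nat.add_zero] at c10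
  -- second store: the bit at `aaddr + 1`
  have lbit : (encodeNat (b.toNat % 2 ^ W)).length ≤ β :=
    lenA (le_trans (le_trans (mod_two_pow_le _ _) hwV) (by omega))
  have c11 := c10.seq (runs_memStore _ (encodeNat (b.toNat % 2 ^ W)) [] [] [] [] [] [] E₁ (encodeNat (aaddr + 1)) β
    (lenA (by omega)) lbit hinv₁.bdd rfl rfl rfl rfl ⟨rfl, rfl, rfl, rfl, rfl, rfl, rfl, rfl, rfl⟩)
  refine c11.of_eq ?_ ?_
  · simp [state, cfgSt, St.zero, F0]
  · -- the cost
    have hL0 : (encLog E).length ≤ (4 * β + 4) * (A + 1) := h.length_encLog_le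
    have hL1 : (encLog E₁).length ≤ (4 * β + 4) * (A + 1) := hinv₁.length_encLog_le
    have hn0 : E.length ≤ A + 1 := h.length_le
    have hn1 : E₁.length ≤ A + 1 := hinv₁.length_le
    have s0 := storeCostD_mono hn0 hL0 β
    have s1 := storeCostD_mono hn1 hL1 β
    have m0 := loadCost_mono hL0 β
    have la : (encodeNat aaddr).length ≤ β := lenA (by omega)
    have la1 : (encodeNat (aaddr + 1)).length ≤ β := lenA (by omega)
    have lf : (flag b).length ≤ 1 := length_flag_le b
    unfold answerCost
    simp only [List.length_nil]
    omega

/-! #### 3SUM in terms of the functional model -/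

section Sublists

variable {α : Type}

/-- Pairs of positions as two-element sublists. [folklore] -/
theorem exists_get₂_iff (Q : α → α → Prop) : ∀ l : List α,
    (∃ j k : Fin l.length, j < k ∧ Q (l.get j) (l.get k)) ↔ ∃ v w, [v, w].Sublist l ∧ Q v w
  | [] => by
    constructor
    · rintro ⟨j, -, -, -⟩; exact j.elim0
    · rintro ⟨v, w, h, -⟩; simp at h
  | x :: l => by
    have ih := exists_get₂_iff Q l
    constructor
    · rintro ⟨j, k, hjk, hQ⟩
      rcases Fin.eq_zero_or_eq_succ k with rfl | ⟨k', rfl⟩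
      · exact absurd hjk (Fin.not_lt_zero j)
      rcases Fin.eq_zero_or_eq_succ j with rfl | ⟨j', rfl⟩
      · refine ⟨x, l.get k', (List.singleton_sublist.2 (List.get_mem l k')).cons_cons x, ?_⟩
        simpa only [List.get_cons_zero, List.get_cons_succ'] using hQ
      · rw [Fin.succ_lt_succ_iff] at hjk
        obtain ⟨v, w, hvw, hQ'⟩ := ih.1 ⟨j', k', hjk, by simpa only [List.get_cons_succ'] using hQ⟩
        exact ⟨v, w, hvw.cons x, hQ'⟩
    · rintro ⟨v, w, hvw, hQ⟩
      rcases List.sublist_cons_iff.1 hvw with h | ⟨r, hr, hr'⟩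
      · obtain ⟨j', k', hjk, hQ'⟩ := ih.2 ⟨v, w, h, hQ⟩
        exact ⟨j'.succ, k'.succ, Fin.succ_lt_succ_iff.2 hjk, by simpa only [List.get_cons_succ'] using hQ'⟩
      · obtain ⟨rfl, rfl⟩ := List.cons.inj hr
        obtain ⟨k', hk'⟩ := List.mem_iff_get.1 (List.singleton_sublist.1 hr')
        refine ⟨0, k'.succ, Fin.succ_pos k', ?_⟩
        simpa only [List.get_cons_zero, List.get_cons_succ', hk'] using hQ

/-- Triples of positions as three-element sublists. [folklore] -/
theorem exists_get₃_iff (P : α → α → α → Prop) : ∀ l : List α,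
    (∃ i j k : Fin l.length, i < j ∧ j < k ∧ P (l.get i) (l.get j) (l.get k)) ↔
      ∃ u v w, [u, v, w].Sublist l ∧ P u v w
  | [] => by
    constructor
    · rintro ⟨i, -, -, -⟩; exact i.elim0
    · rintro ⟨u, v, w, h, -⟩; simp at h
  | x :: l => by
    have ih := exists_get₃_iff P l
    constructor
    · rintro ⟨i, j, k, hij, hjk, hP⟩
      rcases Fin.eq_zero_or_eq_succ j with rfl | ⟨j', rfl⟩
      · exact absurd hij (Fin.not_lt_zero i)
      rcases Fin.eq_zero_or_eq_succ k with rfl | ⟨k', rfl⟩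
      · exact absurd hjk (Fin.not_lt_zero _)
      rw [Fin.succ_lt_succ_iff] at hjk
      rcases Fin.eq_zero_or_eq_succ i with rfl | ⟨i', rfl⟩
      · obtain ⟨v, w, hvw, hQ⟩ := (exists_get₂_iff (P x) l).1 ⟨j', k', hjk, by
          simpa only [List.get_cons_zero, List.get_cons_succ'] using hP⟩
        exact ⟨x, v, w, hvw.cons_cons x, hQ⟩
      · rw [Fin.succ_lt_succ_iff] at hij
        obtain ⟨u, v, w, h, hP'⟩ := ih.1 ⟨i', j', k', hij, hjk, by simpa only [List.get_cons_succ'] using hP⟩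
        exact ⟨u, v, w, h.cons x, hP'⟩
    · rintro ⟨u, v, w, h, hP⟩
      rcases List.sublist_cons_iff.1 h with h | ⟨r, hr, hr'⟩
      · obtain ⟨i', j', k', hij, hjk, hP'⟩ := ih.2 ⟨u, v, w, h, hP⟩
        exact ⟨i'.succ, j'.succ, k'.succ, Fin.succ_lt_succ_iff.2 hij, Fin.succ_lt_succ_iff.2 hjk,
          by simpa only [List.get_cons_succ'] using hP'⟩
      · obtain ⟨rfl, rfl⟩ := List.cons.inj hr
        obtain ⟨j', k', hjk, hQ⟩ := (exists_get₂_iff (P u) l).2 ⟨v, w, hr', hP⟩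
        refine ⟨0, j'.succ, k'.succ, Fin.succ_pos j', Fin.succ_lt_succ_iff.2 hjk, ?_⟩
        simpa only [List.get_cons_zero, List.get_cons_succ'] using hQ

end Sublists

/-- **3SUM in terms of sublists.** [folklore] -/
theorem hasThreeSum_iff_exists_sublist (l : List ℤ) :
    HasThreeSum l ↔ ∃ a b c, [a, b, c].Sublist l ∧ a + b + c = 0 :=
  exists_get₃_iff (fun a b c => a + b + c = 0) l

/-- **The brute force decides 3SUM**: the zig-zag decoded query has a three-sum iff the functional
model `F1` accepts the reversed word list. [folklore] -/
theorem hasThreeSum_iff_F1_reverse (q : List ℕ) :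
    HasThreeSum (q.map Equiv.intEquivNat.symm) ↔ F1 q.reverse = true := by
  rw [hasThreeSum_iff_exists_sublist, F1_eq_true_iff]
  constructor
  · rintro ⟨a, b, c, habc, hsum⟩
    obtain ⟨l', hl', hmap⟩ := List.sublist_map_iff.1 habc
    rcases l' with _ | ⟨u, _ | ⟨v, _ | ⟨w, _ | ⟨t, l''⟩⟩⟩⟩ <;>
      simp only [List.map_cons, List.map_nil, List.cons.injEq, List.nil_eq, reduceCtorEq, and_false, and_true] at hmap
    obtain ⟨rfl, rfl, rfl⟩ := hmap
    refine ⟨w, v, u, ?_, ?_⟩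
    · rw [show [w, v, u] = [u, v, w].reverse from rfl, List.reverse_sublist]; exact hl'
    · rw [tst_eq_true_iff]; omega
  · rintro ⟨u, v, w, huvw, ht⟩
    refine ⟨Equiv.intEquivNat.symm w, Equiv.intEquivNat.symm v, Equiv.intEquivNat.symm u, ?_, ?_⟩
    · have h1 : [w, v, u].Sublist q := by
        rw [← List.reverse_sublist]; simpa using huvw
      simpa using h1.map Equiv.intEquivNat.symm
    · rw [tst_eq_true_iff] at ht; omega

/-! #### One instruction -/

/-- The uniform bound of the code length of the log (values `≤ V`, addresses `≤ V + 1`). [folklore] -/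
def Lmax (β V : ℕ) : ℕ := (4 * β + 4) * (V + 2)

/-- The cost of one instruction of the interpreter with 3SUM queries. [folklore] -/
def stepCostQ (W β V P : ℕ) : ℕ :=
  2 * loadCost (Lmax β V) β + opCost W β β + storeCostQ (Lmax β V) (V + 2) β + qReadCost β V (Lmax β V) +
    C1 V (V * (2 * β + 2)) β + answerCost W β (Lmax β V) (V + 2) + P + 16 * β + 20

/-- Words of a segment of a `V`-bounded memory have `β`-bit numerals. [folklore] -/
theorem forall_readSeg_length_le {mem : ℕ → ℕ} {V β : ℕ} (hV : MemLE V mem) (hβ : (encodeNat V).length ≤ β)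
    (a n : ℕ) : ∀ w ∈ (readSeg mem a n).reverse, (encodeNat w).length ≤ β := by
  intro w hw
  rw [List.mem_reverse, mem_readSeg_iff] at hw
  obtain ⟨i, -, rfl⟩ := hw
  exact (Brick.length_encodeNat_mono (hV _)).trans hβ

/-- **Simulation of one instruction** (with 3SUM queries and the duplicate-free log). From the
configuration file of `⟨some j, mem, …⟩` with the program counter consumed, the code of `M[j] = I`
leads to the configuration file of `step … = some cfg'`, the log invariant being maintained, within
`stepCostQ`. [folklore] -/
theorem runs_instrCodeQ {M : Program} {W : ℕ} {O : List ℕ → List ℕ} (hO : ThreeSumAnswers O)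
    {E : List (List Bool × List Bool)} {mem : ℕ → ℕ} {β V : ℕ} (h : LogInv β (V + 1) E mem) (hV : MemLE V mem)
    (hwV : 2 ^ W - 1 ≤ V) (h1V : 1 ≤ V) (hMV : Program.maxConst M ≤ V) (hβ : (encodeNat (2 * V + 2)).length ≤ β)
    {j : ℕ} {I : Instr} (hI : M[j]? = some I) {cp : ℕ} {qs : List (List ℕ)} {cfg' : Cfg}
    (hs : step M W O zeroCoins ⟨some j, mem, cp, qs⟩ = some cfg') :
    ∃ E', LogInv β (V + 1) E' cfg'.mem ∧
      Runs (instrCodeQ j I) (state (cfgSt W E none []) F0)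
        (state (cfgSt W E' cfg'.pc (flag cfg'.pc.isSome)) F0) (stepCostQ W β V (pcBound M)) := by
  have hIc : I.maxConst ≤ V := le_trans (Instr.maxConst_le_of_getElem? hI) hMV
  have hlenV : ∀ {v}, v ≤ 2 * V + 2 → (encodeNat v).length ≤ β := fun hv => le_trans (Brick.length_encodeNat_mono hv) hβ
  have hjM : j < M.length := (List.getElem?_eq_some_iff.1 hI).1
  have hj1 : j + 1 ≤ pcBound M := by unfold pcBound; omega
  have hclean := iclean_cfgSt W E none []
  have hmemβ : ∀ b, (encodeNat (mem b)).length ≤ β := fun b => hlenV (by have := hV b; omega)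
  have hL : (encLog E).length ≤ Lmax β V := h.length_encLog_le
  have hn : E.length ≤ V + 2 := h.length_le
  have hβV1 : (encodeNat (V + 1)).length ≤ β := hlenV (by omega)
  have hload := fun o (ho : (encodeNat (Operand.const o)).length ≤ β) (dst : AReg) (F : Regs AReg) (hF : F dst = []) =>
    (runs_loadTo hclean h.rep h.bdd o ho dst F hF).mono (loadCost_mono hL β)
  unfold step at hs
  simp only [hI] at hs
  unfold stepCostQ
  cases I with
  | halt =>
    simp only [Option.some.injEq] at hs
    subst hs
    exact ⟨E, h, (Runs.skip _).of_eq (by simp [flag]) (by omega)⟩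
  | jmp t =>
    simp only [Option.some.injEq] at hs
    subst hs
    have ht : t ≤ pcBound M := jumpTarget_le_pcBound (List.mem_of_getElem? hI)
    exact ⟨E, h, (runs_next W E t).of_eq (by simp [flag]) (by omega)⟩
  | op o dst x y =>
    simp only [Option.some.injEq] at hs
    subst hs
    simp only [Instr.maxConst, max_le_iff] at hIc
    set a := x.read mem
    set b := y.read mem
    set v := o.eval W a b
    have hva : a ≤ V := Operand.read_le hV x hIc.2.1
    have hvb : b ≤ V := Operand.read_le hV y hIc.2.2
    have hvv : v ≤ V := BinOp.eval_le hva hwV h1V o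
    have h1 := hload x (hlenV (by omega)) AReg.x F0 rfl
    have h2 := h1.seq (hload y (hlenV (by omega)) AReg.y _ (by simp))
    simp only [AReg.update_file_x, AReg.update_file_y] at h2
    have h3 := h2.seq (runs_opW hclean o a b)
    have h4 := h3.seq (runs_storeCode (W := W) h hmemβ dst (hlenV (by omega)) v (hlenV (by omega)) [] hL hn)
    have h5 := h4.seq (runs_next W (storeLogOp E mem v dst) (j + 1))
    refine ⟨storeLogOp E mem v dst, logInv_storeLogOp h hV (Nat.le_succ V) hβV1 (hlenV (by omega)) dst hIc.1, ?_⟩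
    refine h5.of_eq (by simp [flag]) ?_
    have := opCost_mono W (hlenV (show a ≤ 2 * V + 2 by omega)) (hlenV (show b ≤ 2 * V + 2 by omega))
    omega
  | jz x t =>
    simp only [Option.some.injEq] at hs
    subst hs
    simp only [Instr.maxConst] at hIc
    have ht : t ≤ pcBound M := jumpTarget_le_pcBound (List.mem_of_getElem? hI)
    have hva : x.read mem ≤ V := Operand.read_le hV x hIc
    refine ⟨E, h, ?_⟩
    have h1 := hload x (hlenV (by omega)) AReg.x F0 rfl
    simp only [AReg.update_file_x] at h1
    by_cases h0 : x.read mem = 0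
    · rw [h0, if_pos rfl]
      rw [h0, show encodeNat 0 = [] by decide] at h1
      have hk : state (cfgSt W E none []) (AReg.file [] [] [] [] [] [] [] []) (Sum.inr AReg.x) = [] := by
        simp [state]
      have h2 := h1.seq (Runs.pop_nil (clear (Sum.inr AReg.x) ;; next (j + 1)) (clear (Sum.inr AReg.x) ;; next (j + 1))
        hk (runs_next W E t))
      exact h2.of_eq (by simp [flag]) (by omega)
    · rw [if_neg h0]
      rcases hx : encodeNat (x.read mem) with _ | ⟨bit, rest⟩
      · exact absurd (eq_zero_of_encodeNat_eq_nil hx) h0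
      rw [hx] at h1
      have hlen : rest.length ≤ β := by
        have := hlenV (show x.read mem ≤ 2 * V + 2 by omega); rw [hx] at this; simp at this; omega
      have hbr : Runs (clear (Sum.inr AReg.x) ;; next (j + 1)) (state (cfgSt W E none []) (AReg.file rest [] [] [] [] [] [] []))
          (state (cfgSt W E (some (j + 1)) [true]) F0) (2 * rest.length + 1 + (j + 1 + 1)) := by
        have c1 := runs_clear (Sum.inr AReg.x : K ⊕ AReg) (state (cfgSt W E none []) (AReg.file rest [] [] [] [] [] [] []))
        simp only [state, Sum.elim_inr, AReg.file_x, Sum.update_elim_inr, AReg.update_file_x] at c1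
        exact c1.seq (runs_next W E (j + 1))
      have hk : state (cfgSt W E none []) (AReg.file (bit :: rest) [] [] [] [] [] [] []) (Sum.inr AReg.x) = bit :: rest := by
        simp [state]
      have hupd : Function.update (state (cfgSt W E none []) (AReg.file (bit :: rest) [] [] [] [] [] [] []))
          (Sum.inr AReg.x) rest = state (cfgSt W E none []) (AReg.file rest [] [] [] [] [] [] []) := by
        simp [state]
      cases bit
      · exact (h1.seq (Runs.pop_false' _ _ hk hupd hbr)).of_eq (by simp [flag]) (by omega)
      · exact (h1.seq (Runs.pop_true' _ _ hk hupd hbr)).of_eq (by simp [flag]) (by omega)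
  | rand dst =>
    simp only [Option.some.injEq] at hs
    subst hs
    simp only [Instr.maxConst] at hIc
    simp only [zeroCoins_apply, Nat.zero_mod]
    have e0 : encodeNat 0 = [] := by decide
    have h1 := runs_storeCode (W := W) h hmemβ dst (hlenV (by omega)) 0 (by rw [e0]; simp) [] hL hn
    rw [e0] at h1
    have h2 := h1.seq (runs_next W (storeLogOp E mem 0 dst) (j + 1))
    refine ⟨storeLogOp E mem 0 dst, logInv_storeLogOp h hV (Nat.le_succ V) hβV1 (by rw [e0]; simp) dst hIc, ?_⟩
    exact h2.of_eq (by simp [flag]) (by omega)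
  | query qa ql aa =>
    have hOq : O (readSeg mem (qa.read mem) (ql.read mem)) = _ := hO _
    simp only [hOq, List.map_cons, List.map_nil, List.length_cons, List.length_nil, Nat.zero_add,
      Option.some.injEq] at hs
    subst hs
    simp only [Instr.maxConst, max_le_iff] at hIc
    set qaddr := qa.read mem with hqaddr
    set qlen := ql.read mem with hqlen
    set aaddr := aa.read mem with haaddr
    set q := readSeg mem qaddr qlen with hq
    have hqlV : qlen ≤ V := Operand.read_le hV ql hIc.2.1
    have haV : aaddr ≤ V := Operand.read_le hV aa hIc.2.2
    -- reading the query
    have c1 := runs_qRead (W := W) h hV (hlenV (by omega)) qa ql hIc.1 hIc.2.1 hL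
    rw [← hqaddr, ← hqlen, ← hq] at c1
    -- the brute force
    have hws := forall_readSeg_length_le hV (hlenV (show V ≤ 2 * V + 2 by omega)) qaddr qlen
    rw [← hq] at hws
    have c2 := c1.seq (runs_loop1 (β := β) q.reverse _ false rfl rfl rfl rfl rfl rfl ⟨rfl, rfl, rfl, rfl, rfl, rfl, rfl⟩ hws)
    simp only [Bool.false_or] at c2
    have c2' : Runs (qRead qa ql ;; loop1) (state (cfgSt W E none []) F0)
        (state { cfgSt W E none [] with he := flag (F1 q.reverse) } F0)
        (qReadCost β V (Lmax β V) + C1 q.reverse.length (valItems q.reverse).length β) :=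
      c2.of_eq (by simp [state, cfgSt, St.zero]) le_rfl
    -- writing the answer
    have c3 := c2'.seq (runs_answer h hV hwV le_rfl hβV1 aa hIc.2.2 (F1 q.reverse))
    rw [← haaddr, show V + 1 + 1 = V + 2 from rfl] at c3
    set bv := (F1 q.reverse).toNat % 2 ^ W with hbv
    set E₂ := storeLog (storeLog E (encodeNat aaddr) (encodeNat 1)) (encodeNat (aaddr + 1)) (encodeNat bv) with hE₂
    have c4 := c3.seq (runs_next W E₂ (j + 1))
    have lbv : (encodeNat bv).length ≤ β :=
      hlenV (le_trans (le_trans (mod_two_pow_le _ _) hwV) (by omega))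
    have hinv₁ : LogInv β (V + 1) (storeLog E (encodeNat aaddr) (encodeNat 1)) (Function.update mem aaddr 1) :=
      h.store (by omega) (hlenV (by omega)) (hlenV (by omega))
    have hinv₂ : LogInv β (V + 1) E₂ (Function.update (Function.update mem aaddr 1) (aaddr + 1) bv) :=
      hinv₁.store (by omega) (hlenV (by omega)) lbv
    have hbit : (if HasThreeSum (q.map Equiv.intEquivNat.symm) then 1 else 0) % 2 ^ W = bv := by
      rw [hbv]
      by_cases hT : HasThreeSum (q.map Equiv.intEquivNat.symm)
      · rw [if_pos hT, (hasThreeSum_iff_F1_reverse q).1 hT]; rfl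
      · have hF : F1 q.reverse = false := by
          cases hF1 : F1 q.reverse
          · rfl
          · exact absurd ((hasThreeSum_iff_F1_reverse q).2 hF1) hT
        rw [if_neg hT, hF]; rfl
    refine ⟨E₂, ?_, ?_⟩
    · show LogInv β (V + 1) E₂ (writeSeg (Function.update mem aaddr 1) (aaddr + 1)
        [(if HasThreeSum (q.map Equiv.intEquivNat.symm) then 1 else 0) % 2 ^ W])
      rw [writeSeg_cons, writeSeg_nil, hbit]
      exact hinv₂
    · refine c4.of_eq (by simp [flag]) ?_
      have hlenq : q.reverse.length ≤ V := by simp [hq, hqlV]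
      have hℓ : (valItems q.reverse).length ≤ V * (2 * β + 2) :=
        (length_valItems_le q.reverse hws).trans (Nat.mul_le_mul_right _ hlenq)
      have hC := C1_mono hlenq hℓ β
      unfold Lmax at hC ⊢
      unfold Lmax at c4
      omega

/-! #### Dispatch and one step -/

/-- **Dispatch, hit** (as `runs_dispatchL_hit`, for `dispatchQ`). [folklore] -/
theorem runs_dispatchQ_hit (F : Regs AReg) : ∀ (rest : List Instr) (i d : ℕ) (ρ : St) {I : Instr}
    {R' : Regs (K ⊕ AReg)} {B : ℕ}, ρ.pc = ones d → rest[d]? = some I →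
    Runs (instrCodeQ (i + d) I) (state { ρ with pc := [] } F) R' B → Runs (dispatchQ rest i) (state ρ F) R' (B + 2 * (d + 1))
  | [], i, d, ρ, I, R', B, _, hI, _ => by simp at hI
  | J :: rest, i, 0, ρ, I, R', B, hpc, hI, h => by
    simp only [List.getElem?_cons_zero, Option.some.injEq] at hI
    subst hI
    rw [Nat.add_zero] at h
    have e : ({ ρ with pc := [] } : St) = ρ := by cases ρ; simp only at hpc; simp [hpc]
    rw [e] at h
    exact (Runs.pop_nil _ _ (by simp [state, hpc]) h).of_eq rfl (by omega)
  | J :: rest, i, d + 1, ρ, I, R', B, hpc, hI, h => by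
    simp only [List.getElem?_cons_succ] at hI
    rw [show i + (d + 1) = (i + 1) + d by omega] at h
    have ih := runs_dispatchQ_hit F rest (i + 1) d { ρ with pc := ones d } rfl hI (by simpa using h)
    refine (Runs.pop_true' _ _ (w := ones d) (by simp [state, hpc, ones, List.replicate_succ]) (by simp [state]) ih).of_eq
      rfl (by omega)

/-- **Dispatch, miss** (as `runs_dispatchL_miss`, for `dispatchQ`). [folklore] -/
theorem runs_dispatchQ_miss (F : Regs AReg) : ∀ (rest : List Instr) (i d : ℕ) (ρ : St),
    ρ.pc = ones d → rest.length ≤ d →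
    Runs (dispatchQ rest i) (state ρ F) (state { ρ with pc := [] } F) (2 * d + 1)
  | [], i, d, ρ, hpc, _ => by
    have := runs_clear (Sum.inl K.pc : K ⊕ AReg) (state ρ F)
    simp only [state, Sum.elim_inl, regs_pc, hpc, List.length_replicate, Sum.update_elim_inl, update_regs_pc] at this
    exact this
  | J :: rest, i, 0, ρ, hpc, hd => by simp at hd
  | J :: rest, i, d + 1, ρ, hpc, hd => by
    simp only [List.length_cons, Nat.succ_le_succ_iff] at hd
    have ih := runs_dispatchQ_miss F rest (i + 1) d { ρ with pc := ones d } rfl hd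
    refine (Runs.pop_true' _ _ (w := ones d) (by simp [state, hpc, ones, List.replicate_succ]) (by simp [state]) ih).of_eq
      (by simp) (by omega)

/-- **Simulation of one step of the word RAM with 3SUM queries.** From the configuration file of a
running configuration (`pc = some j`, `j ≤ pcBound M`), the body of the interpreter leads to the
configuration file of `step … = some cfg'`, within `stepCostQ + 2 pcBound + 3`. [folklore] -/
theorem runs_bodyQ_step {M : Program} {W : ℕ} {O : List ℕ → List ℕ} (hO : ThreeSumAnswers O)
    {E : List (List Bool × List Bool)} {mem : ℕ → ℕ} {β V : ℕ} (h : LogInv β (V + 1) E mem) (hV : MemLE V mem)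
    (hwV : 2 ^ W - 1 ≤ V) (h1V : 1 ≤ V) (hMV : Program.maxConst M ≤ V) (hβ : (encodeNat (2 * V + 2)).length ≤ β)
    {j : ℕ} (hj : j ≤ pcBound M) {cp : ℕ} {qs : List (List ℕ)} {cfg' : Cfg}
    (hs : step M W O zeroCoins ⟨some j, mem, cp, qs⟩ = some cfg') :
    ∃ E', LogInv β (V + 1) E' cfg'.mem ∧
      Runs (bodyQ M) (state (cfgSt W E (some j) []) F0)
        (state (cfgSt W E' cfg'.pc (flag cfg'.pc.isSome)) F0) (stepCostQ W β V (pcBound M) + 2 * pcBound M + 3) := by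
  cases hI : M[j]? with
  | none =>
    have hs' := hs
    unfold step at hs'
    simp only [hI, Option.some.injEq] at hs'
    subst hs'
    refine ⟨E, h, ?_⟩
    have hjM : M.length ≤ j := by simpa using (List.getElem?_eq_none_iff.1 hI)
    refine (runs_dispatchQ_miss F0 M 0 j (cfgSt W E (some j) []) rfl hjM).of_eq ?_ (by omega)
    simp [flag, cfgSt]
  | some I =>
    obtain ⟨E', h', hrun⟩ := runs_instrCodeQ hO h hV hwV h1V hMV hβ hI hs
    have hjM : j < M.length := (List.getElem?_eq_some_iff.1 hI).1
    refine ⟨E', h', ?_⟩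
    have := runs_dispatchQ_hit F0 M 0 j (cfgSt W E (some j) []) (I := I) rfl hI
      (by rw [Nat.zero_add]; simpa [cfgSt] using hrun)
    refine this.of_eq rfl ?_
    unfold pcBound; omega

/-! #### Whole runs -/

/-- An iterate of the halted transition stays halted (any oracle). [folklore] -/
theorem iterate_bind_none' {M : Program} {W : ℕ} {O : List ℕ → List ℕ} (n : ℕ) :
    (flip bind (step M W O zeroCoins))^[n] (none : Option Cfg) = none :=
  Function.iterate_fixed rfl n

/-- **Simulation of a halting run with 3SUM queries.** If the word RAM, started in a configuration
`cfg` whose `V`-bounded memory satisfies the log invariant with `E` (counter `≤ pcBound`), halts after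
`n` steps in `c_f` under a 3SUM oracle, then `interpQ M`, started on the configuration file of `cfg`
with the run flag armed iff `cfg` is running, ends on the configuration file of `c_f`, within
`n · (stepCostQ + 2 pcBound + 5) + 1` steps — a cost *linear* in the number of simulated steps.
[folklore] -/
theorem runs_interpQ {M : Program} {W : ℕ} {O : List ℕ → List ℕ} (hO : ThreeSumAnswers O) {β V : ℕ}
    (hwV : 2 ^ W - 1 ≤ V) (h1V : 1 ≤ V) (hMV : Program.maxConst M ≤ V) (hβ : (encodeNat (2 * V + 2)).length ≤ β) :
    ∀ (n : ℕ) (cfg : Cfg) {c_f : Cfg} {E : List (List Bool × List Bool)},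
      LogInv β (V + 1) E cfg.mem → MemLE V cfg.mem → (∀ i, cfg.pc = some i → i ≤ pcBound M) →
      run M W O zeroCoins n cfg = some c_f → c_f.pc = none →
      ∃ E_f, LogInv β (V + 1) E_f c_f.mem ∧
        Runs (interpQ M) (state (cfgSt W E cfg.pc (flag cfg.pc.isSome)) F0) (state (cfgSt W E_f none []) F0)
          (n * (stepCostQ W β V (pcBound M) + 2 * pcBound M + 5) + 1)
  | 0, cfg, c_f, E, h, _, _, hit, hhalt => by
    simp only [run_zero, Option.some.injEq] at hit
    subst hit
    refine ⟨E, h, ?_⟩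
    rw [hhalt]
    exact (Runs.loop_nil _ _ (by simp [state, cfgSt, flag])).of_eq (by simp [flag]) (by simp)
  | n + 1, ⟨pc, mem, cp, qs⟩, c_f, E, h, hV, hpcB, hit, hhalt => by
    cases pc with
    | none =>
      rw [run_succ_of_step_eq_none _ _ _ _ (by unfold step; rfl)] at hit
      exact absurd hit (by simp)
    | some j =>
      cases hs : step M W O zeroCoins ⟨some j, mem, cp, qs⟩ with
      | none => rw [run_succ_of_step_eq_none _ _ _ _ hs] at hit; exact absurd hit (by simp)
      | some cfg' =>
        rw [run_succ_of_step _ _ _ _ hs] at hit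
        have hj : j ≤ pcBound M := hpcB j rfl
        obtain ⟨E', h', hbody⟩ := runs_bodyQ_step hO h hV hwV h1V hMV hβ hj hs
        have hV' : MemLE V cfg'.mem := step_memLE_of_length_le_one hO.length_le hwV h1V hMV hV hs
        obtain ⟨E_f, hf, hrest⟩ := runs_interpQ hO hwV h1V hMV hβ n cfg' h' hV'
          (fun i hi => step_pc_le_pcBound hs hi) hit hhalt
        refine ⟨E_f, hf, ?_⟩
        have hk : state (cfgSt W E (some j) (flag (some j).isSome)) F0 (Sum.inl K.run) = true :: [] := by
          simp [state, cfgSt, flag]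
        have hupd : Function.update (state (cfgSt W E (some j) (flag (some j).isSome)) F0) (Sum.inl K.run) [] =
            state (cfgSt W E (some j) []) F0 := by
          simp [state, cfgSt]
        rw [← hupd] at hbody
        refine (Runs.loop_true hk hbody hrest).of_eq rfl ?_
        have e : (n + 1) * (stepCostQ W β V (pcBound M) + 2 * pcBound M + 5) + 1 =
            (stepCostQ W β V (pcBound M) + 2 * pcBound M + 3) + 2 +
              (n * (stepCostQ W β V (pcBound M) + 2 * pcBound M + 5) + 1) := by ring
        rw [e]

/-! #### The cost of a step is a polynomial -/

/-- **One step costs `O(Z⁵)`** when word size, numeral bound, memory bound and counter bound are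
`≤ Z`: `stepCostQ W β V P + 2 P + 5 ≤ 9100 Z⁵`. [folklore] -/
theorem stepCostQ_le_pow {Z W β V P : ℕ} (hZ : 1 ≤ Z) (hW : W ≤ Z) (hβ : β ≤ Z) (hV : V + 2 ≤ Z) (hP : P ≤ Z) :
    stepCostQ W β V P + 2 * P + 5 ≤ 9100 * Z ^ 5 := by
  have hZ2 : Z ≤ Z ^ 2 := by nlinarith
  have hZ3 : Z ^ 2 ≤ Z ^ 3 := Nat.pow_le_pow_right hZ (by norm_num)
  have hZ4 : Z ^ 3 ≤ Z ^ 4 := Nat.pow_le_pow_right hZ (by norm_num)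
  have hZ5 : Z ^ 4 ≤ Z ^ 5 := Nat.pow_le_pow_right hZ (by norm_num)
  have hVZ : V ≤ Z := by omega
  -- the log code length
  have hL : Lmax β V ≤ 8 * Z ^ 2 := by
    unfold Lmax
    calc (4 * β + 4) * (V + 2) ≤ (8 * Z) * Z := Nat.mul_le_mul (by omega) hV
      _ = 8 * Z ^ 2 := by ring
  set L := Lmax β V with hLdef
  have hL3 : L * (3 * β + 17) ≤ 160 * Z ^ 3 :=
    calc L * (3 * β + 17) ≤ 8 * Z ^ 2 * (20 * Z) := Nat.mul_le_mul hL (by omega)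
      _ = 160 * Z ^ 3 := by ring
  have hload : loadCost L β ≤ 361 * Z ^ 3 := by unfold loadCost; omega
  have hop : opCost W β β ≤ 4000 * Z ^ 2 := by
    unfold opCost
    calc 250 * (W + β + β + 1) ^ 2 ≤ 250 * (4 * Z) ^ 2 := Nat.mul_le_mul_left _ (Nat.pow_le_pow_left (by omega) 2)
      _ = 4000 * Z ^ 2 := by ring
  have hstD : storeCostD (V + 2) L β ≤ 378 * Z ^ 3 := by
    unfold storeCostD
    have h1 : (V + 2) * (26 * L + 60 * β + 63) ≤ Z * (208 * Z ^ 2 + 60 * Z + 63) := Nat.mul_le_mul hV (by omega)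
    have h2 : Z * (208 * Z ^ 2 + 60 * Z + 63) = 208 * Z ^ 3 + 60 * Z ^ 2 + 63 * Z := by ring
    omega
  have hstQ : storeCostQ L (V + 2) β ≤ 565 * Z ^ 3 := by unfold storeCostQ; omega
  have hqr : qReadCost β V L ≤ 973 * Z ^ 4 := by
    unfold qReadCost
    have h1 : β * (20 * V + 5) ≤ Z * (25 * Z) := Nat.mul_le_mul hβ (by omega)
    have h2 : V * (L * (3 * β + 17) + 25 * β + 32) ≤ Z * (160 * Z ^ 3 + 57 * Z) := Nat.mul_le_mul hVZ (by omega)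
    have h3 : Z * (25 * Z) = 25 * Z ^ 2 := by ring
    have h4 : Z * (160 * Z ^ 3 + 57 * Z) = 160 * Z ^ 4 + 57 * Z ^ 2 := by ring
    omega
  have hℓ : V * (2 * β + 2) ≤ 4 * Z ^ 2 :=
    calc V * (2 * β + 2) ≤ Z * (4 * Z) := Nat.mul_le_mul hVZ (by omega)
      _ = 4 * Z ^ 2 := by ring
  have hT3 : T3 β ≤ 829 * Z := by unfold T3; omega
  have hC3 : C3 V (V * (2 * β + 2)) β ≤ 897 * Z ^ 3 := by
    unfold C3
    have h1 : V * (13 * (V * (2 * β + 2)) + T3 β + 2 * β + 13) ≤ Z * (52 * Z ^ 2 + 844 * Z) :=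
      Nat.mul_le_mul hVZ (by omega)
    have h2 : Z * (52 * Z ^ 2 + 844 * Z) = 52 * Z ^ 3 + 844 * Z ^ 2 := by ring
    omega
  have hC2 : C2 V (V * (2 * β + 2)) β ≤ 1008 * Z ^ 4 := by
    unfold C2
    have h1 : V * (23 * (V * (2 * β + 2)) + C3 V (V * (2 * β + 2)) β + 2 * β + 16) ≤
        Z * (92 * Z ^ 2 + 897 * Z ^ 3 + 18 * Z) := Nat.mul_le_mul hVZ (by omega)
    have h2 : Z * (92 * Z ^ 2 + 897 * Z ^ 3 + 18 * Z) = 897 * Z ^ 4 + 92 * Z ^ 3 + 18 * Z ^ 2 := by ring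
    omega
  have hC1 : C1 V (V * (2 * β + 2)) β ≤ 1119 * Z ^ 5 := by
    unfold C1
    have h1 : V * (23 * (V * (2 * β + 2)) + C2 V (V * (2 * β + 2)) β + 2 * β + 16) ≤
        Z * (92 * Z ^ 2 + 1008 * Z ^ 4 + 18 * Z) := Nat.mul_le_mul hVZ (by omega)
    have h2 : Z * (92 * Z ^ 2 + 1008 * Z ^ 4 + 18 * Z) = 1008 * Z ^ 5 + 92 * Z ^ 3 + 18 * Z ^ 2 := by ring
    omega
  have hans : answerCost W β L (V + 2) ≤ 1314 * Z ^ 3 := by unfold answerCost; omega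
  unfold stepCostQ
  rw [← hLdef]
  omega

end Literature.Computability.Cryptography.WordRAM.ToTM2
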